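/-
Copyright: statement-level skeleton of a published paper (lit-balaban cell, Phase-2 proof seat p13, gen 2). No proof
claims beyond what the kernel checks below.
-/
import Literature.MathematicalPhysics.QuantumFieldTheory.Balaban1983to89.B4Sect5RandomWalk
import Literature.MathematicalPhysics.QuantumFieldTheory.Balaban1983to89.B4Sect5Proof

/-!
# `Balaban1983to89.B4Sect5CubeBounds` — T. Bałaban, *Regularity and decay of lattice Green's functions*, Commun.
Math. Phys. **89** (1983) 571–597 [Balaban1983RegularityDecay] (= B4), Sect. 5, pp. 594–596 [PDF 24–26]:
**the cube system (5.11)–(5.12) BUILT on `ℤ^d`, the two kernel estimates of p. 595, (5.15), and the lattice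
instances of (5.16)–(5.17) — all from (5.6) alone**

statement-level skeleton of published theorems with citation tags; proofs where landed; nothing here is a claim
about the Yang–Mills mass gap.  Unit `lit-balaban-p13-g2` (cell lit-balaban, Phase 2; rows B4.Eq5.11 / B4.Eq5.15 of
ROWS-B4; companion of `…B4Sect5RandomWalk` (p244548), which proves (5.13), (5.14), (5.16), (5.17) for an ABSTRACT
`CubeSystem` and takes `‖R‖ < 1` / the (5.17)-weight `θ < 1` as hypotheses).  VALUE = those hypotheses DISCHARGED on
the unit lattice: for every finite `Λ ⊂ ℤ^d`, every `A` on `L²(Λ; ℝ^N)` with (5.6) and every cube size `M`, the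
printed data (5.11)–(5.12) form a `CubeSystem` (`cubeSystem_lattice`); the printed kernel estimates hold with explicit
constants (`abs_rPair_diag_le'`, `abs_rPair_offDiag_le`, `abs_rPair_offDiag_le'`); (5.15) holds (`ineq515`);
`‖R‖ ≤ K_R/M` (`norm_rOp_le`); and for `M` large — explicitly `M ≥ 5`, `M > K_R`, `M > Θ₁` — the Neumann series (5.16) and
the generalized random walk expansion (5.17) converge to `A_Λ^{−1}` (`hasSum516_lattice`, `hasSum517_lattice`,
`hasSum517_lattice'`).  NOT summit progress; nothing landed is edited (`…B4Sect5RandomWalk`, `…B4Sect5Proof`,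
`…B6GOmega`, `…B4Commutators25to211` are imported).

## The print (verbatim, pp. 575, 594–596)

p. 594 [PDF 24]: *"We define the sets □_j = Λ∩{x ∈ Z^d : −M ≤ x_μ − Mj_μ < M, μ = 1,…,d}, j ∈ Z^d, (5.11) and we
introduce the same partition of unity h_j as before. In the sequel we restrict ourselves to these j's for which
□_j ≠ ∅. Let us define C_j = C_{□_j}, C = Σ_j h_jC_jh_j. (5.12)"* — "as before" = p. 575 [PDF 5]: *"h_j(x) =
Π_{μ=1}^d h_{j_μ}(x_μ), and functions h_j(x), j ∈ Z, of one real variable x are defined as h_j(x) = h(x/M − j),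
h ∈ C₀^∞(]−2/3, 2/3[), h(x) = 1 for x ∈ [−1/3, 1/3], and it is chosen in such a way that Σ_{j∈Z} h_j² = 1."*

p. 595 [PDF 25]: *"R = Σ_{j,j′}R_{j,j′}C_{j′}h_{j′}, R_{j,j} = −□_j[A,h_j]□_j, R_{j,j′} = −(1−□_{j′})h²_jAh_{j′} for j ≠ j′.
(5.14) … We have |R_{j,j}(x,x′)| = |A(x,x′)(h_j(x′) − h_j(x))| ≤ c₀e^{−δ₀|x−x′|}O(1)|x−x′|/M, x, x′ ∈ □_j,
|R_{j,j′}(x,x′)| = |(1−□_{j′})(x)h²_j(x)A(x,x′)h_{j′}(x′)| ≤ (1−□_{j′}(x))c₀e^{−δ₀|x−x′|}h_{j′}(x′) ≤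
c₀e^{−½δ₀|x−x′|}e^{−(1/6)δ₀M} for x ∈ □_j, x′ ∈ □_{j′}, and these estimates imply that the norms of the operators
R_{j,j′} have bounds ‖R_{j,j′}‖ ≤ αe^{−δ₂|j−j′|} (5.15) for α depending on M and arbitrarily small if M is sufficiently
large, δ₂ depending on δ₀, e.g. δ₂ = ¼δ₀. From these bounds it follows that ‖R‖ ≤ max{sup_jΣ_{j′}‖R_{j,j′}‖,
sup_{j′}Σ_j‖R_{j,j′}‖}γ₀^{−1} ≤ αγ₀^{−1}Σ_{j∈Z^d}e^{−δ₂|j|} is small for M large and C_Λ = C(I−R)^{−1} = Σ_{n=0}^∞ CR^n,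
(5.16) which can be given a random walk form: C_Λ = Σ_ω h_{ω₀}C_{ω₀}h_{ω₀}R_{ω₁,ω₂}C_{ω₂}h_{ω₂}·…·
R_{ω_{2n−1},ω_{2n}}C_{ω_{2n}}h_{ω_{2n}}, ω = (ω₀,ω₁,…,ω_{2n}), ω_i are arbitrary indices j, but satisfying the
restrictions max_{μ=1,…,d}|ω_{2i,μ} − ω_{2i+1,μ}| ≤ 1 for i = 0,1,…,n−1, n ≥ 0. (5.17)"*;  p. 596 [PDF 26]: *"Finally
we fix M such that γ₀^{−1}αe^{dδ₂}c₂^{2d} < 1"*.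

## Reading / typing decisions (what is proved, and not more)

* `A` is the operator on `L²(Λ; ℝ^N)` — the print's `A_Λ = ΛAΛ` — assumed to satisfy (5.6) on Λ in the tree's
  entrywise form `B4.Hyp56 Λ A γ₀ c₀ δ₀` (for `A_Λ = B4.compress h A₀` this is `B6GOmega.hyp56_compress`); `|x − x′|`
  is the sup-distance of `ℤ^d`, as in `…B4`.
* THE PROFILE.  `prof t = cos((π/2)·clamp₀₁(3|t| − 1))`: `= 1` on `[−1/3, 1/3]`, `= 0` off `]−2/3, 2/3[`, values in
  `[0,1]`, `Σ_{j∈ℤ} prof(t − j)² = 1` (`sum_prof_sq`), LIPSCHITZ with constant `3π/2` (`abs_prof_sub_le`).  The print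
  takes `h ∈ C₀^∞`; smoothness is NOT used on pp. 594–596 (only `|h_j(x′) − h_j(x)| ≤ O(1)|x − x′|/M` and the support),
  so the printed `O(1)` is `3πd/2` here; a `C^∞` profile is not provided (`-- TODO(general form)` below).
* `h_j(x) = Π_μ prof(x_μ/M − j_μ)` (`hfun`); `□_j` = (5.11) (`InBox`, `boxSet`, `box`); the labels with `□_j ≠ ∅`
  (`labels M Λ = ⋃_{x∈Λ} cand M x`); `□_j`, `h_j` as block-diagonal operators (`pFam`, `hFam`, via
  `B4Commutators25to211.mulH`); `C_j = ι(A_{□_j})^{−1}ιᵀ` (`cOp`/`cFam`, via `B6GOmega.inclMatrix`, invertibility by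
  `B4Sect5Proof.isUnit_of_hyp56`).
* NORMS.  `‖·‖` is the `ℓ^∞ → ℓ^∞` operator norm of `Matrix (B4.Idx Λ N) (B4.Idx Λ N) ℝ` (max absolute row sum,
  `Matrix.linftyOpNormedRing`, scope `Matrix.Norms.Operator`) — a complete submultiplicative norm, which is all that
  (5.16)–(5.17) need; the print's `‖R_{j,j′}‖` is the `L²` operator norm.  (5.15) is proved in BOTH norms — `ineq515`
  (`ℓ^∞`, row sums) and `ineq515_l2` (`‖R_{j,j′}φ‖₂ ≤ αe^{−δ₂|j−j′|}‖φ‖₂`, by the finite Schur test `SchurTest.sum_sq_le`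
  on row and column sums) — with `α(M) = (3πd/2M)·M₀ + c₀NK_d(δ₀/4)e^{−δ₀M/10}` (`alpha515`; `M₀ =
  B4Sect5Proof.weightConst`, `K_d = B4Sect5Proof.latticeConst`) and `δ₂ = ¼δ₀`, for `M ≥ 5`.
* CONSTANTS (all explicit functions of `d, N, γ₀, c₀, δ₀`): `cRow = (2/γ₀)NK_d(δ₁)` bounds the row sums of every
  `C_j` ((5.7) for `A_{□_j}`, `B4Sect5Proof.inv_compress_decay`); `K_R = (3πd/2)·2^d·cRow·M₀` (`kR`) gives
  `‖R‖ ≤ K_R/M`; `θ(M) = 3^d·α(M)·cRow·K_d(δ₀/4)` (`theta517`) is the (5.17)-weight of `…B4Sect5RandomWalk.hasSum517`,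
  and `θ(M) ≤ Θ₁/M` (`thetaConst`, `theta517_le`).  "We fix M" = any `M ≥ 5` with `M > K_R`, `M > Θ₁` (`hasSum517_lattice'`).
* PRIOR ART IN THE TREE (searched; none is reused because none is the (5.11) system on a subset `Λ ⊂ ℤ^d` in the
  `B4.Idx`/`Matrix` model of `…B4`): `…B5TorusPartition` (the (1.118) partition of B5 on a finite TORUS, normalised
  Lipschitz bumps with support of side `4M₀`, operators on `EuclideanSpace`), `…B5SmoothPartition` (its `C^{1,1}`
  refinement, profile `cos(½πσ(·))` without plateau), `…B12PartitionUnity270` (a `C^∞` profile `ζ` with `Σ_n ζ = 1`,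
  not `Σ_n ζ² = 1`).  The telescoping lemma `abs_prod_sub_prod_le` is re-proved here in the `Fin d`/`|·| ≤ 1` shape
  used below (twins exist in `…T4ActivityInterface`, `…B5TorusPartition`, …; importing them would pull unrelated
  theories into B4 Sect. 5).
* NOT done here: (5.18)–(5.27), i.e. the derivation of (5.7), (5.8), (5.10) from the walk expansion (the tree proves
  (5.7)–(5.10) by finite Combes–Thomas in `…B4Sect5Proof`); the print's Schur-type line for the FULL `R` in `L²`
  (only its `ℓ^∞` form `norm_rOp_le` is proved, which is what (5.16)–(5.17) consume here); a `C^∞` profile.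

## What is kernel-checked (no sorries; axioms propext / Classical.choice / Quot.sound)

§1 the profile (`prof`: plateau, support, Lipschitz, partition); §2 `hfun` (bounds, Lipschitz `3πd/(2M)`, support,
`Σ_j h_j² = 1`); §3 the cubes (5.11) (`InBox ↔ cand`, **≤ 2^d cubes through a point** `card_filter_inBox_le` (p. 578),
the margin `dist_ge_of_not_inBox` (`M/3`), support separation); §4 the operators and **`cubeSystem_lattice`**; §5
entries and row sums (`abs_cOp_le`, `sum_abs_cOp_le`, `sum_abs_mul_dist_le`, `rOp_apply`,
**`norm_rOp_le : ‖R‖ ≤ K_R/M`**); §6 **`hasSum516_lattice`** ((5.16): `M > K_R ⇒ HasSum (n ↦ CRⁿ) A⁻¹`); §7 the two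
kernel estimates, **`ineq515`** ((5.15), `ℓ^∞`) and **`ineq515_l2`** ((5.15), `L²`); §8 the restriction (5.17) (`Adj`), its locality
(`hFam_mul_rPair_eq_zero`), the weight bound `sum_norm_bFac_le`, **`hasSum517_lattice`**,
`hasSum517_lattice_restricted`, `theta517_le`, **`hasSum517_lattice'`** (every `M ≥ 5` with `M > K_R`, `M > Θ₁`).
-/

-- TODO(general form): a `C^∞` profile `h` (e.g. `cos((π/2)·Real.smoothTransition(3|t| − 1))`) with the same
-- plateau/support/partition properties, if the second-difference bounds `|Δ^ηh_j| ≤ O(M^{−2})` of Sect. 2 are needed.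

-- v2 (same seat): APPEND of §7's `L²` block — (5.15) in the print's `L²` operator norm (`ineq515_l2`, finite Schur test
-- on row AND column sums: `sum_abs_mul_dist_col_le`, `colSum_rPair_*`, `rowSum_rPair_le`, `colSum_rPair_le`); v1 = p245229,
-- no v1 declaration changed (header bullets updated).

namespace Literature.MathematicalPhysics.QuantumFieldTheory.Balaban1983to89.B4Sect5CubeBounds

open scoped BigOperators
open Finset Real

/-! ## §1 The profile `h` (p. 575), Lipschitz version -/

/-- the clamp `u ↦ max(0, min(1, u))` to `[0, 1]`. [folklore] (bookkeeping for Bałaban, CMP **89**, Sect. 5) -/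
noncomputable def clamp01 (u : ℝ) : ℝ := max 0 (min 1 u)

/-- `0 ≤ clamp₀₁ u`. [folklore] (bookkeeping for Bałaban, CMP **89**, Sect. 5) -/
private theorem clamp01_nonneg (u : ℝ) : 0 ≤ clamp01 u := le_max_left _ _

/-- `clamp₀₁ u ≤ 1`. [folklore] (bookkeeping for Bałaban, CMP **89**, Sect. 5) -/
private theorem clamp01_le_one (u : ℝ) : clamp01 u ≤ 1 := max_le zero_le_one (min_le_left _ _)

/-- `clamp₀₁ u = 0` for `u ≤ 0`. [folklore] (bookkeeping for Bałaban, CMP **89**, Sect. 5) -/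
private theorem clamp01_of_nonpos {u : ℝ} (hu : u ≤ 0) : clamp01 u = 0 := by
  unfold clamp01; rw [min_eq_right (by linarith : u ≤ 1), max_eq_left hu]

/-- `clamp₀₁ u = 1` for `u ≥ 1`. [folklore] (bookkeeping for Bałaban, CMP **89**, Sect. 5) -/
private theorem clamp01_of_one_le {u : ℝ} (hu : 1 ≤ u) : clamp01 u = 1 := by
  unfold clamp01; rw [min_eq_left hu]; norm_num

/-- the symmetry `clamp₀₁(1 − u) = 1 − clamp₀₁ u` (behind `h(s)² + h(s−1)² = 1`). [folklore] (bookkeeping for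
Bałaban, CMP **89**, Sect. 5) -/
private theorem clamp01_one_sub (u : ℝ) : clamp01 (1 - u) = 1 - clamp01 u := by
  unfold clamp01
  rcases le_total u 0 with hu | hu
  · rw [min_eq_right (by linarith : u ≤ 1), max_eq_left hu, min_eq_left (by linarith : (1:ℝ) ≤ 1 - u)]; norm_num
  rcases le_total 1 u with hu1 | hu1
  · rw [min_eq_left hu1, min_eq_right (by linarith : 1 - u ≤ 1), max_eq_left (by linarith : 1 - u ≤ 0)]; norm_num
  · rw [min_eq_right hu1, max_eq_right hu, min_eq_right (by linarith : 1 - u ≤ 1),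
      max_eq_right (by linarith : (0:ℝ) ≤ 1 - u)]

/-- `clamp₀₁` is 1-Lipschitz. [folklore] (bookkeeping for Bałaban, CMP **89**, Sect. 5) -/
private theorem abs_clamp01_sub_le (u v : ℝ) : |clamp01 u - clamp01 v| ≤ |u - v| := by
  unfold clamp01
  calc |max 0 (min 1 u) - max 0 (min 1 v)| ≤ max |(0 : ℝ) - 0| |min 1 u - min 1 v| :=
        abs_max_sub_max_le_max _ _ _ _
    _ ≤ max |(0 : ℝ) - 0| (max |(1:ℝ) - 1| |u - v|) :=
        max_le_max le_rfl (abs_min_sub_min_le_max _ _ _ _)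
    _ = |u - v| := by simp [abs_nonneg]

/-- THE PROFILE `h(t) = cos((π/2)·clamp₀₁(3|t| − 1))` standing in for the print's *"h ∈ C₀^∞(]−2/3, 2/3[), h(x) = 1
for x ∈ [−1/3, 1/3], and it is chosen in such a way that Σ_{j∈Z} h_j² = 1"* (p. 575): `h = 1` on `[−1/3, 1/3]`, `h =
0` off `]−2/3, 2/3[`, `0 ≤ h ≤ 1`, Lipschitz with constant `3π/2`, `Σ_{j∈ℤ} h(t − j)² = 1` — Lipschitz instead of
`C^∞` (see the module docstring). [cite: Balaban1983RegularityDecay, p.575 (partition of unity) & (5.11) p.594] -/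
noncomputable def prof (t : ℝ) : ℝ := Real.cos (π / 2 * clamp01 (3 * |t| - 1))

/-- *"h(x) = 1 for x ∈ [−1/3, 1/3]"* (p. 575). [cite: Balaban1983RegularityDecay, p.575] -/
theorem prof_of_abs_le {t : ℝ} (ht : |t| ≤ 1 / 3) : prof t = 1 := by
  rw [prof, clamp01_of_nonpos (by linarith), mul_zero, Real.cos_zero]

/-- *"h ∈ C₀(]−2/3, 2/3[)"*: `h(t) = 0` for `|t| ≥ 2/3` (p. 575). [cite: Balaban1983RegularityDecay, p.575] -/
theorem prof_of_le_abs {t : ℝ} (ht : 2 / 3 ≤ |t|) : prof t = 0 := by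
  rw [prof, clamp01_of_one_le (by linarith), mul_one, Real.cos_pi_div_two]

/-- `0 ≤ h`. [cite: Balaban1983RegularityDecay, p.575] -/
theorem prof_nonneg (t : ℝ) : 0 ≤ prof t := by
  unfold prof
  apply Real.cos_nonneg_of_mem_Icc
  constructor <;> nlinarith [Real.pi_pos, clamp01_nonneg (3 * |t| - 1), clamp01_le_one (3 * |t| - 1)]

/-- `h ≤ 1`. [cite: Balaban1983RegularityDecay, p.575] -/
theorem prof_le_one (t : ℝ) : prof t ≤ 1 := Real.cos_le_one _

/-- `|h| ≤ 1`. [cite: Balaban1983RegularityDecay, p.575] -/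
theorem abs_prof_le_one (t : ℝ) : |prof t| ≤ 1 := by
  rw [abs_of_nonneg (prof_nonneg t)]; exact prof_le_one t

/-- the profile is Lipschitz: `|h(t) − h(s)| ≤ (3π/2)|t − s|` — the source of *"|h_j(x′) − h_j(x)| ≤ O(1)|x−x′|/M"*
(p. 595). [cite: Balaban1983RegularityDecay, p.595 (first kernel estimate)] -/
theorem abs_prof_sub_le (t s : ℝ) : |prof t - prof s| ≤ 3 * π / 2 * |t - s| := by
  unfold prof
  calc |Real.cos (π / 2 * clamp01 (3 * |t| - 1)) - Real.cos (π / 2 * clamp01 (3 * |s| - 1))|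
      ≤ |π / 2 * clamp01 (3 * |t| - 1) - π / 2 * clamp01 (3 * |s| - 1)| := Real.abs_cos_sub_cos_le _ _
    _ = π / 2 * |clamp01 (3 * |t| - 1) - clamp01 (3 * |s| - 1)| := by
        rw [← mul_sub, abs_mul, abs_of_pos (by positivity : (0:ℝ) < π / 2)]
    _ ≤ π / 2 * (3 * |t - s|) := by
        refine mul_le_mul_of_nonneg_left ((abs_clamp01_sub_le _ _).trans ?_) (by positivity)
        rw [show 3 * |t| - 1 - (3 * |s| - 1) = 3 * (|t| - |s|) by ring, abs_mul, abs_of_pos (by norm_num : (0:ℝ) < 3)]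
        exact mul_le_mul_of_nonneg_left (abs_abs_sub_abs_le_abs_sub t s) (by norm_num)
    _ = 3 * π / 2 * |t - s| := by ring

/-- the partition identity on one period: `h(s)² + h(s − 1)² = 1` for `s ∈ [0,1]`. [cite:
Balaban1983RegularityDecay, p.575 (Σ_j h_j² = 1)] -/
theorem prof_sq_add_prof_sq {s : ℝ} (h0 : 0 ≤ s) (h1 : s ≤ 1) : prof s ^ 2 + prof (s - 1) ^ 2 = 1 := by
  unfold prof
  rw [abs_of_nonneg h0, abs_of_nonpos (by linarith : s - 1 ≤ 0),
    show 3 * -(s - 1) - 1 = 1 - (3 * s - 1) by ring, clamp01_one_sub, mul_sub, mul_one,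
    Real.cos_pi_div_two_sub, Real.cos_sq_add_sin_sq]

/-- off the two nearest integers the profile vanishes: `h(t − j) = 0` for `j ∉ {⌊t⌋, ⌊t⌋+1}`. [cite:
Balaban1983RegularityDecay, p.575] -/
theorem prof_sub_int_eq_zero {t : ℝ} {j : ℤ} (h0 : j ≠ ⌊t⌋) (h1 : j ≠ ⌊t⌋ + 1) : prof (t - j) = 0 := by
  apply prof_of_le_abs
  have hfl := Int.floor_le t
  have hlt := Int.lt_floor_add_one t
  rcases lt_or_gt_of_ne h0 with hlt' | hgt'
  · have : (j : ℝ) ≤ ⌊t⌋ - 1 := by exact_mod_cast Int.le_sub_one_of_lt hlt'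
    rw [le_abs]; left; linarith
  · have h2 : ⌊t⌋ + 2 ≤ j := by omega
    have : ((⌊t⌋ : ℝ) + 2) ≤ j := by exact_mod_cast h2
    rw [le_abs]; right; linarith

/-- *"Σ_{j∈Z} h_j² = 1"* (p. 575): `Σ_{j∈S} h(t − j)² = 1` for every finite `S ∋ ⌊t⌋, ⌊t⌋ + 1`. [cite:
Balaban1983RegularityDecay, p.575] -/
theorem sum_prof_sq (t : ℝ) (S : Finset ℤ) (h0 : ⌊t⌋ ∈ S) (h1 : ⌊t⌋ + 1 ∈ S) :
    ∑ j ∈ S, prof (t - j) ^ 2 = 1 := by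
  have hvan : ∀ j ∈ S, j ∉ ({⌊t⌋, ⌊t⌋ + 1} : Finset ℤ) → prof (t - j) ^ 2 = 0 := by
    intro j _ hj
    rw [Finset.mem_insert, Finset.mem_singleton, not_or] at hj
    rw [prof_sub_int_eq_zero hj.1 hj.2, zero_pow two_ne_zero]
  rw [← Finset.sum_subset (show ({⌊t⌋, ⌊t⌋ + 1} : Finset ℤ) ⊆ S by
    intro j hj; rw [Finset.mem_insert, Finset.mem_singleton] at hj; rcases hj with rfl | rfl <;> assumption) hvan]
  rw [Finset.sum_pair (by omega : (⌊t⌋ : ℤ) ≠ ⌊t⌋ + 1)]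
  push_cast
  rw [show t - ((⌊t⌋ : ℝ) + 1) = (t - ⌊t⌋) - 1 by ring]
  exact prof_sq_add_prof_sq (by linarith [Int.floor_le t]) (by linarith [Int.lt_floor_add_one t])

/-! ## §2 The partition of unity `h_j(x) = Π_μ h(x_μ/M − j_μ)` (p. 575, p. 594) -/

variable {d : ℕ}

/-- telescoping: `|Π_μ a_μ − Π_μ b_μ| ≤ Σ_μ |a_μ − b_μ|` when all factors have absolute value `≤ 1`. [folklore]
(bookkeeping for Bałaban, CMP **89**, Sect. 5) -/
private theorem abs_prod_sub_prod_le (s : Finset (Fin d)) (a b : Fin d → ℝ) (ha : ∀ μ, |a μ| ≤ 1) (hb : ∀ μ, |b μ| ≤ 1) :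
    |∏ μ ∈ s, a μ - ∏ μ ∈ s, b μ| ≤ ∑ μ ∈ s, |a μ - b μ| := by
  classical
  induction s using Finset.induction_on with
  | empty => simp
  | insert i s hi ih =>
      rw [Finset.prod_insert hi, Finset.prod_insert hi, Finset.sum_insert hi]
      have hpa : |∏ μ ∈ s, a μ| ≤ 1 := by
        rw [Finset.abs_prod]; exact Finset.prod_le_one (fun μ _ => abs_nonneg _) (fun μ _ => ha μ)
      calc |a i * ∏ μ ∈ s, a μ - b i * ∏ μ ∈ s, b μ|
          = |(a i - b i) * ∏ μ ∈ s, a μ + b i * (∏ μ ∈ s, a μ - ∏ μ ∈ s, b μ)| := by ring_nf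
        _ ≤ |(a i - b i) * ∏ μ ∈ s, a μ| + |b i * (∏ μ ∈ s, a μ - ∏ μ ∈ s, b μ)| := abs_add_le _ _
        _ = |a i - b i| * |∏ μ ∈ s, a μ| + |b i| * |∏ μ ∈ s, a μ - ∏ μ ∈ s, b μ| := by rw [abs_mul, abs_mul]
        _ ≤ |a i - b i| * 1 + 1 * |∏ μ ∈ s, a μ - ∏ μ ∈ s, b μ| :=
            add_le_add (mul_le_mul_of_nonneg_left hpa (abs_nonneg _))
              (mul_le_mul_of_nonneg_right (hb i) (abs_nonneg _))
        _ ≤ |a i - b i| + ∑ μ ∈ s, |a μ - b μ| := by rw [mul_one, one_mul]; exact add_le_add le_rfl ih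

/-- *"h_j(x) = Π_{μ=1}^d h_{j_μ}(x_μ), … h_j(x) = h(x/M − j)"* (p. 575): `h_j(x) = Π_μ h(x_μ/M − j_μ)` on `ℤ^d`,
cubes of size `M`. [cite: Balaban1983RegularityDecay, p.575 & (5.11) p.594] -/
noncomputable def hfun (M : ℕ) (j x : Fin d → ℤ) : ℝ := ∏ μ, prof ((x μ : ℝ) / M - j μ)

/-- `0 ≤ h_j`. [cite: Balaban1983RegularityDecay, p.575] -/
theorem hfun_nonneg (M : ℕ) (j x : Fin d → ℤ) : 0 ≤ hfun M j x :=
  Finset.prod_nonneg fun _ _ => prof_nonneg _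

/-- `h_j ≤ 1`. [cite: Balaban1983RegularityDecay, p.575] -/
theorem hfun_le_one (M : ℕ) (j x : Fin d → ℤ) : hfun M j x ≤ 1 :=
  Finset.prod_le_one (fun _ _ => prof_nonneg _) fun _ _ => prof_le_one _

/-- `|h_j| ≤ 1`. [cite: Balaban1983RegularityDecay, p.575] -/
theorem abs_hfun_le_one (M : ℕ) (j x : Fin d → ℤ) : |hfun M j x| ≤ 1 := by
  rw [abs_of_nonneg (hfun_nonneg M j x)]; exact hfun_le_one M j x

/-- **the `O(1)/M` of p. 595**: `|h_j(x) − h_j(x′)| ≤ (3πd/(2M))·|x − x′|` (sup-distance). [cite: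
Balaban1983RegularityDecay, p.595 (first kernel estimate)] -/
theorem abs_hfun_sub_le {M : ℕ} (hM : 0 < M) (j x y : Fin d → ℤ) :
    |hfun M j x - hfun M j y| ≤ 3 * π * d / (2 * M) * dist x y := by
  unfold hfun
  refine (abs_prod_sub_prod_le Finset.univ _ _ (fun μ => abs_prof_le_one _) (fun μ => abs_prof_le_one _)).trans ?_
  have hμ : ∀ μ, |prof ((x μ : ℝ) / M - j μ) - prof ((y μ : ℝ) / M - j μ)| ≤ 3 * π / 2 * (dist x y / M) := by
    intro μ
    refine (abs_prof_sub_le _ _).trans (mul_le_mul_of_nonneg_left ?_ (by positivity))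
    rw [show (x μ : ℝ) / M - j μ - ((y μ : ℝ) / M - j μ) = ((x μ : ℝ) - y μ) / M by ring, abs_div,
      abs_of_pos (by exact_mod_cast hM : (0:ℝ) < M)]
    refine div_le_div_of_nonneg_right ?_ (by exact_mod_cast hM.le)
    have := dist_le_pi_dist x y μ
    rwa [Int.dist_eq] at this
  calc ∑ μ, |prof ((x μ : ℝ) / M - j μ) - prof ((y μ : ℝ) / M - j μ)| ≤ ∑ _μ : Fin d, 3 * π / 2 * (dist x y / M) :=
        Finset.sum_le_sum fun μ _ => hμ μ
    _ = 3 * π * d / (2 * M) * dist x y := by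
        rw [Finset.sum_const, Finset.card_univ, Fintype.card_fin, nsmul_eq_mul]; ring

/-- the support of `h_j`: `h_j(x) ≠ 0 ⇒ |x_μ/M − j_μ| < 2/3` for every `μ` (*"h ∈ C₀(]−2/3,2/3[)"*). [cite:
Balaban1983RegularityDecay, p.575] -/
theorem abs_lt_of_hfun_ne_zero {M : ℕ} {j x : Fin d → ℤ} (h : hfun M j x ≠ 0) (μ : Fin d) :
    |(x μ : ℝ) / M - j μ| < 2 / 3 := by
  by_contra hge
  exact h (Finset.prod_eq_zero (Finset.mem_univ μ) (prof_of_le_abs (not_lt.mp hge)))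

/-- the (`2^d`) labels `j` with possibly `h_j(x) ≠ 0` or `x ∈ □_j`: `j_μ ∈ {⌊x_μ/M⌋, ⌊x_μ/M⌋ + 1}`. [cite:
Balaban1983RegularityDecay, (5.11) p.594; p.578 «at most 2^d cubes □_j»] -/
noncomputable def cand (M : ℕ) (x : Fin d → ℤ) : Finset (Fin d → ℤ) :=
  Fintype.piFinset fun μ => ({⌊(x μ : ℝ) / M⌋, ⌊(x μ : ℝ) / M⌋ + 1} : Finset ℤ)

/-- `#cand = 2^d`. [cite: Balaban1983RegularityDecay, p.578 «at most 2^d cubes □_j»] -/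
theorem card_cand (M : ℕ) (x : Fin d → ℤ) : (cand M x).card = 2 ^ d := by
  rw [cand, Fintype.card_piFinset,
    Finset.prod_congr rfl fun μ _ => Finset.card_pair (show ⌊(x μ : ℝ) / M⌋ ≠ ⌊(x μ : ℝ) / M⌋ + 1 by omega)]
  simp

/-- `h_j(x) = 0` unless `j ∈ cand M x`. [cite: Balaban1983RegularityDecay, p.575] -/
theorem hfun_eq_zero_of_not_mem_cand {M : ℕ} {j x : Fin d → ℤ} (hj : j ∉ cand M x) : hfun M j x = 0 := by
  rw [cand, Fintype.mem_piFinset] at hj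
  push Not at hj
  obtain ⟨μ, hμ⟩ := hj
  rw [Finset.mem_insert, Finset.mem_singleton, not_or] at hμ
  exact Finset.prod_eq_zero (Finset.mem_univ μ) (prof_sub_int_eq_zero hμ.1 hμ.2)

/-- **`Σ_j h_j(x)² = 1`** (p. 575; p. 594 *"the same partition of unity h_j as before"*) over every finite label set
containing `cand M x`. [cite: Balaban1983RegularityDecay, p.575 & (5.12) p.594] -/
theorem sum_hfun_sq (M : ℕ) (x : Fin d → ℤ) (J : Finset (Fin d → ℤ)) (hJ : cand M x ⊆ J) :
    ∑ j ∈ J, hfun M j x ^ 2 = 1 := by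
  rw [← Finset.sum_subset hJ fun j _ hj => by rw [hfun_eq_zero_of_not_mem_cand hj, zero_pow two_ne_zero]]
  unfold cand hfun
  simp_rw [← Finset.prod_pow]
  rw [← Finset.prod_univ_sum (fun μ => ({⌊(x μ : ℝ) / M⌋, ⌊(x μ : ℝ) / M⌋ + 1} : Finset ℤ))
    (fun μ jμ => prof ((x μ : ℝ) / M - jμ) ^ 2)]
  refine Finset.prod_eq_one fun μ _ => ?_
  exact sum_prof_sq _ _ (Finset.mem_insert_self _ _) (Finset.mem_insert_of_mem (Finset.mem_singleton_self _))

/-! ## §3 The cubes (5.11): `□_j`, at most `2^d` through a point, the margin `M/3` -/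

/-- **(5.11)** p. 594 [PDF 24], verbatim: *"□_j = Λ∩{x ∈ Z^d : −M ≤ x_μ − Mj_μ < M, μ = 1,…,d}, j ∈ Z^d"* — the
lattice condition `x ∈ {…}` (membership in Λ is added in `boxSet`/`box`). [cite: Balaban1983RegularityDecay, (5.11)
p.594] -/
def InBox (M : ℕ) (j x : Fin d → ℤ) : Prop := ∀ μ, -(M : ℤ) ≤ x μ - M * j μ ∧ x μ - M * j μ < M

/-- decidability of membership in `□_j`. [cite: Balaban1983RegularityDecay, (5.11) p.594] -/
instance instDecidableInBox (M : ℕ) (j x : Fin d → ℤ) : Decidable (InBox M j x) := by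
  unfold InBox; infer_instance

/-- one coordinate of (5.11): `−M ≤ a − Mb < M ↔ b ∈ {⌊a/M⌋, ⌊a/M⌋ + 1}`. [cite: Balaban1983RegularityDecay, (5.11)
p.594] -/
theorem inBox_coord_iff {M : ℕ} (hM : 0 < M) (a b : ℤ) :
    (-(M : ℤ) ≤ a - M * b ∧ a - M * b < M) ↔ (b = ⌊(a : ℝ) / M⌋ ∨ b = ⌊(a : ℝ) / M⌋ + 1) := by
  have hMr : (0 : ℝ) < M := by exact_mod_cast hM
  constructor
  · rintro ⟨h1, h2⟩
    have h1r : -(M : ℝ) ≤ a - M * b := by exact_mod_cast h1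
    have h2r : (a : ℝ) - M * b < M := by exact_mod_cast h2
    rcases le_or_gt (M * b) a with hle | hlt
    · left; symm
      rw [Int.floor_eq_iff]
      have hler : (M : ℝ) * b ≤ a := by exact_mod_cast hle
      constructor
      · rw [le_div_iff₀ hMr]; linarith
      · rw [div_lt_iff₀ hMr]; linarith
    · right
      have : ⌊(a : ℝ) / M⌋ = b - 1 := by
        rw [Int.floor_eq_iff]
        have hltr : (a : ℝ) < M * b := by exact_mod_cast hlt
        push_cast
        constructor
        · rw [le_div_iff₀ hMr]; linarith
        · rw [div_lt_iff₀ hMr]; linarith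
      omega
  · rintro (rfl | rfl)
    · have h1 := Int.floor_le ((a : ℝ) / M)
      have h2 := Int.lt_floor_add_one ((a : ℝ) / M)
      rw [div_lt_iff₀ hMr] at h2
      rw [le_div_iff₀ hMr] at h1
      constructor
      · have : (M : ℝ) * ⌊(a : ℝ) / M⌋ ≤ a + M := by linarith
        have : (M : ℤ) * ⌊(a : ℝ) / M⌋ ≤ a + M := by exact_mod_cast this
        linarith
      · have : (a : ℝ) < M * ⌊(a : ℝ) / M⌋ + M := by linarith
        have : a < (M : ℤ) * ⌊(a : ℝ) / M⌋ + M := by exact_mod_cast this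
        linarith
    · have h1 := Int.floor_le ((a : ℝ) / M)
      have h2 := Int.lt_floor_add_one ((a : ℝ) / M)
      rw [div_lt_iff₀ hMr] at h2
      rw [le_div_iff₀ hMr] at h1
      constructor
      · have : (M : ℝ) * (⌊(a : ℝ) / M⌋ + 1) ≤ a + M := by linarith
        have : (M : ℤ) * (⌊(a : ℝ) / M⌋ + 1) ≤ a + M := by exact_mod_cast this
        linarith
      · have : (a : ℝ) < M * (⌊(a : ℝ) / M⌋ + 1) + M := by nlinarith
        have : a < (M : ℤ) * (⌊(a : ℝ) / M⌋ + 1) + M := by exact_mod_cast this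
        linarith

/-- `x ∈ □_j ↔ j ∈ cand M x`. [cite: Balaban1983RegularityDecay, (5.11) p.594] -/
theorem inBox_iff_mem_cand {M : ℕ} (hM : 0 < M) (j x : Fin d → ℤ) : InBox M j x ↔ j ∈ cand M x := by
  rw [cand, Fintype.mem_piFinset]
  refine forall_congr' fun μ => ?_
  rw [inBox_coord_iff hM, Finset.mem_insert, Finset.mem_singleton]

/-- **each point lies in at most `2^d` of the cubes `□_j`** (p. 578: *"Of course the first situation occurs for at
most 2^d cubes □_j"*; used silently in the `sup_j Σ_{j′}` of p. 595). [cite: Balaban1983RegularityDecay, (5.11)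
p.594; p.578] -/
theorem card_filter_inBox_le {M : ℕ} (hM : 0 < M) (S : Finset (Fin d → ℤ)) (x : Fin d → ℤ) :
    (S.filter fun j => InBox M j x).card ≤ 2 ^ d := by
  rw [← card_cand M x]
  apply Finset.card_le_card
  intro j hj
  rw [Finset.mem_filter] at hj
  exact (inBox_iff_mem_cand hM j x).mp hj.2

/-- `supp h_j ⊆ □_j`. [cite: Balaban1983RegularityDecay, (5.11)–(5.12) p.594] -/
theorem inBox_of_hfun_ne_zero {M : ℕ} (hM : 0 < M) {j x : Fin d → ℤ} (h : hfun M j x ≠ 0) : InBox M j x := by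
  intro μ
  have hμ := abs_lt_of_hfun_ne_zero h μ
  have hMr : (0 : ℝ) < M := by exact_mod_cast hM
  rw [abs_lt] at hμ
  obtain ⟨h1, h2⟩ := hμ
  have e : (x μ : ℝ) / M - j μ = ((x μ : ℝ) - M * j μ) / M := by field_simp
  rw [e] at h1 h2
  rw [div_lt_iff₀ hMr] at h2
  rw [lt_div_iff₀ hMr] at h1
  constructor
  · have : -(M : ℝ) ≤ (x μ : ℝ) - M * j μ := by linarith
    exact_mod_cast this
  · have : (x μ : ℝ) - M * j μ < M := by linarith
    exact_mod_cast this

/-- THE MARGIN behind the second kernel estimate: `x ∉ □_{j′}` and `h_{j′}(x′) ≠ 0` give `|x − x′| ≥ M/3` (so that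
`e^{−½δ₀|x−x′|} ≤ e^{−(1/6)δ₀M}`, p. 595). [cite: Balaban1983RegularityDecay, p.595 (second kernel estimate)] -/
theorem dist_ge_of_not_inBox {M : ℕ} (hM : 0 < M) {j x x' : Fin d → ℤ} (hx : ¬ InBox M j x)
    (hx' : hfun M j x' ≠ 0) : (M : ℝ) / 3 ≤ dist x x' := by
  unfold InBox at hx
  push Not at hx
  obtain ⟨μ, hμ⟩ := hx
  have h' := abs_lt_of_hfun_ne_zero hx' μ
  have hMr : (0 : ℝ) < M := by exact_mod_cast hM
  have e : (x' μ : ℝ) / M - j μ = ((x' μ : ℝ) - M * j μ) / M := by field_simp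
  rw [e, abs_div, abs_of_pos hMr, div_lt_iff₀ hMr, abs_lt] at h'
  have hcoord : (M : ℝ) / 3 ≤ |(x μ : ℝ) - x' μ| := by
    by_cases hc : -(M : ℤ) ≤ x μ - M * j μ
    · have h2 := hμ hc
      have h2r : (M : ℝ) ≤ (x μ : ℝ) - M * j μ := by exact_mod_cast h2
      rw [le_abs]; left; linarith
    · push Not at hc
      have hcr : (x μ : ℝ) - M * j μ < -M := by exact_mod_cast hc
      rw [le_abs]; right; linarith
  refine hcoord.trans ?_
  have := dist_le_pi_dist x x' μ
  rwa [Int.dist_eq] at this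

/-- separation of supports: `h_j(x) ≠ 0`, `h_{j′}(x′) ≠ 0 ⇒ |x − x′| ≥ M(|j − j′| − 4/3)` (behind the
`e^{−δ₂|j−j′|}` of (5.15)). [cite: Balaban1983RegularityDecay, (5.15) p.595] -/
theorem dist_ge_of_hfun_ne_zero {M : ℕ} (hM : 0 < M) {j j' x x' : Fin d → ℤ} (hx : hfun M j x ≠ 0)
    (hx' : hfun M j' x' ≠ 0) : (M : ℝ) * (dist j j' - 4 / 3) ≤ dist x x' := by
  have hMr : (0 : ℝ) < M := by exact_mod_cast hM
  have hcoord : ∀ μ, dist (j μ) (j' μ) ≤ dist x x' / M + 4 / 3 := by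
    intro μ
    have h1 := abs_lt_of_hfun_ne_zero hx μ
    have h2 := abs_lt_of_hfun_ne_zero hx' μ
    have h3 : |(j μ : ℝ) - j' μ| ≤ |((x μ : ℝ) - x' μ) / M| + 4 / 3 := by
      have := abs_sub_le ((j μ : ℝ)) ((x μ : ℝ) / M) (j' μ)
      have e1 : |(j μ : ℝ) - (x μ : ℝ) / M| = |(x μ : ℝ) / M - j μ| := abs_sub_comm _ _
      have := abs_sub_le ((x μ : ℝ) / M) ((x' μ : ℝ) / M) (j' μ)
      have e2 : (x μ : ℝ) / M - (x' μ : ℝ) / M = ((x μ : ℝ) - x' μ) / M := by ring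
      rw [e2] at this
      linarith
    rw [abs_div, abs_of_pos hMr] at h3
    have h4 : |(x μ : ℝ) - x' μ| ≤ dist x x' := by
      have := dist_le_pi_dist x x' μ; rwa [Int.dist_eq] at this
    rw [Int.dist_eq]
    exact h3.trans (by gcongr)
  have hd : dist j j' ≤ dist x x' / M + 4 / 3 := (dist_pi_le_iff (by positivity)).mpr hcoord
  calc (M : ℝ) * (dist j j' - 4 / 3) ≤ M * (dist x x' / M) := by
        apply mul_le_mul_of_nonneg_left _ hMr.le; linarith
    _ = dist x x' := by field_simp

/-! ## §4 (5.11)–(5.12) as operators on `L²(Λ; ℝ^N)`: the lattice `CubeSystem` -/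

section Lattice

open Literature.MathematicalPhysics.QuantumFieldTheory.Balaban1983to89
open B4Commutators25to211 B4GaugeCovariance B4Sect5RandomWalk B4Sect5Proof B6GOmega
open scoped Matrix

variable {N : ℕ}

/-- entries of `mulH f` — [B4]'s multiplication operator `φ ↦ hφ` (`B4Commutators25to211.mulH`): `δ_{pq}f(p)`.
[cite: Balaban1983RegularityDecay, (2.2)–(2.5) pp.575–576; (5.12) p.594] -/
theorem mulH_apply {X ι : Type*} [Fintype X] [Fintype ι] [DecidableEq X] [DecidableEq ι] (f : X → ℝ)
    (p q : X × ι) : mulH (ι := ι) f p q = if p = q then f p.1 else 0 := by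
  unfold mulH blockDiag
  rw [blockOp_apply]
  by_cases h1 : p.1 = q.1
  · by_cases h2 : p.2 = q.2
    · simp [h1, h2, Prod.ext_iff]
    · simp [h1, h2, Prod.ext_iff]
  · simp [h1, Prod.ext_iff]

/-- `(B·h)(x,x′) = B(x,x′)h(x′)` for the multiplication operator `h`. [cite: Balaban1983RegularityDecay,
(5.12)–(5.14) pp.594–595] -/
theorem mul_mulH_apply {X ι : Type*} [Fintype X] [Fintype ι] [DecidableEq X] [DecidableEq ι]
    (B : Matrix (X × ι) (X × ι) ℝ) (f : X → ℝ) (p q : X × ι) : (B * mulH (ι := ι) f) p q = B p q * f q.1 := by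
  rw [Matrix.mul_apply]
  simp_rw [mulH_apply]
  rw [Finset.sum_eq_single q]
  · simp
  · intro r _ hr; simp [hr]
  · intro h; exact absurd (Finset.mem_univ q) h

/-- `(h·B)(x,x′) = h(x)B(x,x′)` for the multiplication operator `h`. [cite: Balaban1983RegularityDecay,
(5.12)–(5.14) pp.594–595] -/
theorem mulH_mul_apply {X ι : Type*} [Fintype X] [Fintype ι] [DecidableEq X] [DecidableEq ι]
    (f : X → ℝ) (B : Matrix (X × ι) (X × ι) ℝ) (p q : X × ι) : (mulH (ι := ι) f * B) p q = f p.1 * B p q := by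
  rw [Matrix.mul_apply]
  simp_rw [mulH_apply]
  rw [Finset.sum_eq_single p]
  · simp
  · intro r _ hr; simp [Ne.symm hr]
  · intro h; exact absurd (Finset.mem_univ p) h

/-- entries of the commutator `[A,h] = Ah − hA`: *"A(x,x′)(h_j(x′) − h_j(x))"* (p. 595). [cite:
Balaban1983RegularityDecay, p.595] -/
theorem comm_mulH_apply {X ι : Type*} [Fintype X] [Fintype ι] [DecidableEq X] [DecidableEq ι]
    (B : Matrix (X × ι) (X × ι) ℝ) (f : X → ℝ) (p q : X × ι) :
    (B * mulH (ι := ι) f - mulH (ι := ι) f * B) p q = B p q * (f q.1 - f p.1) := by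
  rw [Matrix.sub_apply, mul_mulH_apply, mulH_mul_apply]; ring

variable {Λ : Finset (Fin d → ℤ)}

/-- *"In the sequel we restrict ourselves to these j's for which □_j ≠ ∅"* (p. 594): the label set `⋃_{x∈Λ} cand M
x`. [cite: Balaban1983RegularityDecay, (5.11) p.594] -/
noncomputable def labels (M : ℕ) (Λ : Finset (Fin d → ℤ)) : Finset (Fin d → ℤ) := Λ.biUnion (cand M)

/-- `cand M x ⊆ labels` for `x ∈ Λ`. [cite: Balaban1983RegularityDecay, (5.11) p.594] -/
theorem cand_subset_labels {M : ℕ} {x : Fin d → ℤ} (hx : x ∈ Λ) : cand M x ⊆ labels M Λ :=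
  Finset.subset_biUnion_of_mem (cand M) hx

/-- `□_j` of (5.11) as a finite set of lattice points (`Λ ∩ {…}`). [cite: Balaban1983RegularityDecay, (5.11) p.594]
-/
def boxSet (M : ℕ) (Λ : Finset (Fin d → ℤ)) (j : Fin d → ℤ) : Finset (Fin d → ℤ) := Λ.filter (InBox M j)

/-- `□_j ⊆ Λ`. [cite: Balaban1983RegularityDecay, (5.11) p.594] -/
theorem boxSet_subset (M : ℕ) (Λ : Finset (Fin d → ℤ)) (j : Fin d → ℤ) : boxSet M Λ j ⊆ Λ :=
  Finset.filter_subset _ _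

/-- membership in `□_j`. [cite: Balaban1983RegularityDecay, (5.11) p.594] -/
theorem mem_boxSet {M : ℕ} {j x : Fin d → ℤ} : x ∈ boxSet M Λ j ↔ x ∈ Λ ∧ InBox M j x := Finset.mem_filter

/-- `□_j` as a set of sites of `Λ`. [cite: Balaban1983RegularityDecay, (5.11) p.594] -/
def box (M : ℕ) (Λ : Finset (Fin d → ℤ)) (j : Fin d → ℤ) : Finset ↥Λ :=
  Finset.univ.filter fun x => InBox M j (x : Fin d → ℤ)

/-- membership in `□_j` (sites). [cite: Balaban1983RegularityDecay, (5.11) p.594] -/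
theorem mem_box {M : ℕ} {j : Fin d → ℤ} {x : ↥Λ} : x ∈ box M Λ j ↔ InBox M j (x : Fin d → ℤ) := by
  simp [box]

/-- the index of a point of `Λ′ ⊆ Λ` in `L²(Λ′)` (inverse of `B4.inclIdx` on its range). [folklore] (bookkeeping for
Bałaban, CMP **89**, Sect. 5) -/
def resIdx {Λ' : Finset (Fin d → ℤ)} (p : B4.Idx Λ N) (hp : (p.1 : Fin d → ℤ) ∈ Λ') : B4.Idx Λ' N :=
  (⟨(p.1 : Fin d → ℤ), hp⟩, p.2)

/-- `inclIdx ∘ resIdx = id` on the range (bookkeeping for `A_Λ = ΛAΛ`). [cite: Balaban1983RegularityDecay, Sect. 5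
Theorem p.594 (A_Λ = ΛAΛ)] -/
theorem inclIdx_resIdx {Λ' : Finset (Fin d → ℤ)} (h : Λ' ⊆ Λ) (p : B4.Idx Λ N) (hp : (p.1 : Fin d → ℤ) ∈ Λ') :
    B4.inclIdx h (resIdx p hp) = p := rfl

/-- `resIdx ∘ inclIdx = id` (bookkeeping for `A_Λ = ΛAΛ`). [cite: Balaban1983RegularityDecay, Sect. 5 Theorem p.594
(A_Λ = ΛAΛ)] -/
theorem resIdx_inclIdx {Λ' : Finset (Fin d → ℤ)} (h : Λ' ⊆ Λ) (k : B4.Idx Λ' N) :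
    resIdx (B4.inclIdx h k) k.1.2 = k := rfl

/-- `ι ιᵀ` = multiplication by the indicator of `Λ′` — the projection written `Λ′` in the print's `A_{Λ′} = Λ′AΛ′`
and `□_j` in (5.13). [cite: Balaban1983RegularityDecay, Sect. 5 Theorem p.594 (A_Λ = ΛAΛ); (5.13)] -/
theorem inclMatrix_mul_transpose {Λ' : Finset (Fin d → ℤ)} (h : Λ' ⊆ Λ) :
    inclMatrix (N := N) h * (inclMatrix (N := N) h)ᵀ =
      mulH (ι := Fin N) (fun x : ↥Λ => if (x : Fin d → ℤ) ∈ Λ' then (1 : ℝ) else 0) := by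
  ext p q
  rw [mulH_apply, Matrix.mul_apply]
  simp only [Matrix.transpose_apply, inclMatrix_apply]
  by_cases hp : (p.1 : Fin d → ℤ) ∈ Λ'
  · rw [Finset.sum_eq_single (resIdx p hp)]
    · rw [inclIdx_resIdx]; simp [hp, eq_comm]
    · intro k _ hk
      have : p ≠ B4.inclIdx h k := by
        intro e; apply hk; subst e; rfl
      simp [this]
    · intro h0; exact absurd (Finset.mem_univ _) h0
  · rw [Finset.sum_eq_zero]
    · simp [hp]
    · intro k _
      have : p ≠ B4.inclIdx h k := by
        intro e; apply hp; rw [e]; exact k.1.2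
      simp [this]

/-- entries of the zero-extension `ι B ιᵀ` of an operator `B` on `L²(Λ′)` (how `C_j = C_{□_j}` acts on `L²(Λ)` in
(5.12)). [cite: Balaban1983RegularityDecay, (5.12) p.594] -/
theorem conj_apply {Λ' : Finset (Fin d → ℤ)} (h : Λ' ⊆ Λ) (B : Matrix (B4.Idx Λ' N) (B4.Idx Λ' N) ℝ)
    (p q : B4.Idx Λ N) :
    (inclMatrix (N := N) h * B * (inclMatrix (N := N) h)ᵀ) p q =
      if hp : (p.1 : Fin d → ℤ) ∈ Λ' then
        if hq : (q.1 : Fin d → ℤ) ∈ Λ' then B (resIdx p hp) (resIdx q hq) else 0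
      else 0 := by
  rw [Matrix.mul_assoc, Matrix.mul_apply]
  simp only [inclMatrix_apply]
  by_cases hp : (p.1 : Fin d → ℤ) ∈ Λ'
  · rw [dif_pos hp, Finset.sum_eq_single (resIdx p hp)]
    · rw [inclIdx_resIdx, if_pos rfl, one_mul, Matrix.mul_apply]
      simp only [Matrix.transpose_apply, inclMatrix_apply]
      by_cases hq : (q.1 : Fin d → ℤ) ∈ Λ'
      · rw [dif_pos hq, Finset.sum_eq_single (resIdx q hq)]
        · rw [inclIdx_resIdx]; simp
        · intro k _ hk
          have : q ≠ B4.inclIdx h k := by intro e; apply hk; subst e; rfl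
          simp [this]
        · intro h0; exact absurd (Finset.mem_univ _) h0
      · rw [dif_neg hq, Finset.sum_eq_zero]
        intro k _
        have : q ≠ B4.inclIdx h k := by intro e; apply hq; rw [e]; exact k.1.2
        simp [this]
    · intro k _ hk
      have : p ≠ B4.inclIdx h k := by intro e; apply hk; subst e; rfl
      simp [this]
    · intro h0; exact absurd (Finset.mem_univ _) h0
  · rw [dif_neg hp, Finset.sum_eq_zero]
    intro k _
    have : p ≠ B4.inclIdx h k := by intro e; apply hp; rw [e]; exact k.1.2
    simp [this]

variable (N)

/-- the operators `□_j` (multiplication by the indicator of the cube), `j ∈ labels`. [cite: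
Balaban1983RegularityDecay, (5.11) p.594] -/
noncomputable def pFam (M : ℕ) (Λ : Finset (Fin d → ℤ)) :
    ↥(labels M Λ) → Matrix (B4.Idx Λ N) (B4.Idx Λ N) ℝ :=
  fun j => mulH (ι := Fin N) (boxInd (fun j' : ↥(labels M Λ) => box M Λ j'.1) j)

/-- the operators `h_j`, `j ∈ labels`. [cite: Balaban1983RegularityDecay, (5.12) p.594] -/
noncomputable def hFam (M : ℕ) (Λ : Finset (Fin d → ℤ)) :
    ↥(labels M Λ) → Matrix (B4.Idx Λ N) (B4.Idx Λ N) ℝ :=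
  fun j => mulH (ι := Fin N) (fun x : ↥Λ => hfun M j.1 x)

variable {N}

/-- **(5.12)** *"C_j = C_{□_j}"* = `(A_{□_j})^{−1}` (p. 594: `C_Λ = A_Λ^{−1}`, `A_Λ = ΛAΛ`), extended by zero to
`L²(Λ)`: `ι(A_{□_j})^{−1}ιᵀ`. [cite: Balaban1983RegularityDecay, (5.12) p.594] -/
noncomputable def cOp (M : ℕ) (A : Matrix (B4.Idx Λ N) (B4.Idx Λ N) ℝ) (j : Fin d → ℤ) :
    Matrix (B4.Idx Λ N) (B4.Idx Λ N) ℝ :=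
  inclMatrix (N := N) (boxSet_subset M Λ j) * (B4.compress (boxSet_subset M Λ j) A)⁻¹ *
    (inclMatrix (N := N) (boxSet_subset M Λ j))ᵀ

/-- the family `C_j`, `j ∈ labels`. [cite: Balaban1983RegularityDecay, (5.12) p.594] -/
noncomputable def cFam (M : ℕ) (A : Matrix (B4.Idx Λ N) (B4.Idx Λ N) ℝ) :
    ↥(labels M Λ) → Matrix (B4.Idx Λ N) (B4.Idx Λ N) ℝ :=
  fun j => cOp M A j.1

/-- `□_j = ι_jι_jᵀ`. [cite: Balaban1983RegularityDecay, (5.11) p.594] -/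
theorem pFam_eq (M : ℕ) (j : ↥(labels M Λ)) :
    pFam N M Λ j = inclMatrix (N := N) (boxSet_subset M Λ j.1) * (inclMatrix (N := N) (boxSet_subset M Λ j.1))ᵀ := by
  rw [inclMatrix_mul_transpose, pFam]
  congr 1
  funext x
  simp only [boxInd, mem_box, mem_boxSet, Finset.coe_mem, true_and]

/-- `Σ_{j ∈ labels} h_j(x)² = 1` on `Λ`. [cite: Balaban1983RegularityDecay, (5.12) p.594] -/
theorem sum_hfun_sq_labels (M : ℕ) (x : ↥Λ) : ∑ j : ↥(labels M Λ), hfun M j.1 x ^ 2 = 1 := by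
  rw [Finset.sum_coe_sort (labels M Λ) (fun j => hfun M j x ^ 2)]
  exact sum_hfun_sq M (x : Fin d → ℤ) (labels M Λ) (cand_subset_labels x.2)

/-- `ι_jᵀι_j = 1` on `L²(□_j)`. [cite: Balaban1983RegularityDecay, (5.12) p.594] -/
theorem transpose_mul_inclMatrix (M : ℕ) (j : Fin d → ℤ) :
    (inclMatrix (N := N) (boxSet_subset M Λ j))ᵀ * inclMatrix (N := N) (boxSet_subset M Λ j) = 1 :=
  inclMatrix_transpose_mul_self _

/-- `□_jC_j = C_j`. [cite: Balaban1983RegularityDecay, (5.12) p.594] -/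
theorem pFam_mul_cFam (M : ℕ) (A : Matrix (B4.Idx Λ N) (B4.Idx Λ N) ℝ) (j : ↥(labels M Λ)) :
    pFam N M Λ j * cFam M A j = cFam M A j := by
  rw [pFam_eq, cFam, cOp]
  simp only [Matrix.mul_assoc]
  rw [← Matrix.mul_assoc ((inclMatrix (N := N) _)ᵀ) (inclMatrix (N := N) _), transpose_mul_inclMatrix,
    Matrix.one_mul]

/-- `C_j□_j = C_j`. [cite: Balaban1983RegularityDecay, (5.12) p.594] -/
theorem cFam_mul_pFam (M : ℕ) (A : Matrix (B4.Idx Λ N) (B4.Idx Λ N) ℝ) (j : ↥(labels M Λ)) :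
    cFam M A j * pFam N M Λ j = cFam M A j := by
  rw [pFam_eq, cFam, cOp]
  simp only [Matrix.mul_assoc]
  rw [← Matrix.mul_assoc ((inclMatrix (N := N) _)ᵀ) (inclMatrix (N := N) _), transpose_mul_inclMatrix,
    Matrix.one_mul]

/-- `□_jA□_jC_j = □_j` — `C_j` inverts `A_{□_j}` on `L²(□_j)`; (5.6) makes every compression invertible
(`B4Sect5Proof.isUnit_of_hyp56`, `B6GOmega.hyp56_compress`). [cite: Balaban1983RegularityDecay, (5.12) p.594] -/
theorem locInv_lattice (M : ℕ) {A : Matrix (B4.Idx Λ N) (B4.Idx Λ N) ℝ} {γ₀ c₀ δ₀ : ℝ}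
    (hγ : 0 < γ₀) (hc : 0 ≤ c₀) (hδ : 0 ≤ δ₀) (hA : B4.Hyp56 Λ A γ₀ c₀ δ₀) (j : ↥(labels M Λ)) :
    pFam N M Λ j * A * pFam N M Λ j * cFam M A j = pFam N M Λ j := by
  have hunit : IsUnit (B4.compress (boxSet_subset M Λ j.1) A).det :=
    (Matrix.isUnit_iff_isUnit_det _).mp (isUnit_of_hyp56 hγ (hyp56_compress _ hγ.le hc hδ hA))
  rw [pFam_eq, cFam, cOp]
  simp only [Matrix.mul_assoc]
  rw [← Matrix.mul_assoc ((inclMatrix (N := N) _)ᵀ) (inclMatrix (N := N) _), transpose_mul_inclMatrix,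
    Matrix.one_mul, ← Matrix.mul_assoc A (inclMatrix (N := N) _) _,
    ← Matrix.mul_assoc ((inclMatrix (N := N) _)ᵀ) (A * inclMatrix (N := N) _) _,
    ← Matrix.mul_assoc ((inclMatrix (N := N) _)ᵀ) A (inclMatrix (N := N) _), inclMatrix_conj,
    ← Matrix.mul_assoc (B4.compress _ A) _ _, Matrix.mul_nonsing_inv _ hunit, Matrix.one_mul]

/-- **THE LATTICE CUBE SYSTEM**: under (5.6), for every cube size `M ≥ 1`, the printed data (5.11)–(5.12) on `L²(Λ;
ℝ^N)` form a `B4Sect5RandomWalk.CubeSystem` — so (5.13), (5.14), (5.16), (5.17) of that file apply to them. [cite: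
Balaban1983RegularityDecay, (5.11)–(5.12) p.594] -/
theorem cubeSystem_lattice {M : ℕ} (hM : 0 < M) {A : Matrix (B4.Idx Λ N) (B4.Idx Λ N) ℝ} {γ₀ c₀ δ₀ : ℝ}
    (hγ : 0 < γ₀) (hc : 0 ≤ c₀) (hδ : 0 ≤ δ₀) (hA : B4.Hyp56 Λ A γ₀ c₀ δ₀) :
    CubeSystem A (pFam N M Λ) (hFam N M Λ) (cFam M A) :=
  cubeSystem_matrix A (fun j' : ↥(labels M Λ) => box M Λ j'.1) (fun j x => hfun M j.1 x) (cFam M A)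
    (sum_hfun_sq_labels M) (fun _ _ hx => mem_box.mpr (inBox_of_hfun_ne_zero hM hx))
    (pFam_mul_cFam M A) (cFam_mul_pFam M A) (locInv_lattice M hγ hc hδ hA)

end Lattice

/-! ## §5 Kernel entries and row sums: `|C_j|`, `Σ|A|·dist ≤ M₀`, `|R|`, `‖R‖ ≤ K_R/M` -/

section Entries

open Literature.MathematicalPhysics.QuantumFieldTheory.Balaban1983to89
open B4Commutators25to211 B4GaugeCovariance B4Sect5RandomWalk B4Sect5Proof B6GOmega
open scoped Matrix Matrix.Norms.Operator

variable {N : ℕ} {Λ : Finset (Fin d → ℤ)}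

/-- entries of `C_j`. [cite: Balaban1983RegularityDecay, (5.12) p.594] -/
theorem cOp_apply (M : ℕ) (A : Matrix (B4.Idx Λ N) (B4.Idx Λ N) ℝ) (j : Fin d → ℤ) (p q : B4.Idx Λ N) :
    cOp M A j p q =
      if hp : (p.1 : Fin d → ℤ) ∈ boxSet M Λ j then
        if hq : (q.1 : Fin d → ℤ) ∈ boxSet M Λ j then
          (B4.compress (boxSet_subset M Λ j) A)⁻¹ (resIdx p hp) (resIdx q hq) else 0
      else 0 := by
  rw [cOp, conj_apply]

/-- `C_j(x,x′) = 0` for `x ∉ □_j`. [cite: Balaban1983RegularityDecay, (5.12) p.594] -/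
theorem cOp_eq_zero_left {M : ℕ} (A : Matrix (B4.Idx Λ N) (B4.Idx Λ N) ℝ) {j : Fin d → ℤ} {p : B4.Idx Λ N}
    (hp : ¬ InBox M j (p.1 : Fin d → ℤ)) (q : B4.Idx Λ N) : cOp M A j p q = 0 := by
  rw [cOp_apply, dif_neg]
  exact fun h => hp (mem_boxSet.mp h).2

/-- `C_j(x,x′) = 0` for `x′ ∉ □_j`. [cite: Balaban1983RegularityDecay, (5.12) p.594] -/
theorem cOp_eq_zero_right {M : ℕ} (A : Matrix (B4.Idx Λ N) (B4.Idx Λ N) ℝ) {j : Fin d → ℤ} (p : B4.Idx Λ N)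
    {q : B4.Idx Λ N} (hq : ¬ InBox M j (q.1 : Fin d → ℤ)) : cOp M A j p q = 0 := by
  rw [cOp_apply]
  split_ifs with hp hq'
  · exact absurd (mem_boxSet.mp hq').2 hq
  · rfl
  · rfl

variable {γ₀ c₀ δ₀ : ℝ}

/-- **the local inverses decay, uniformly in `j`, `Λ`**: `|C_j(x,x′)| ≤ (2/γ₀)e^{−δ₁|x−x′|}` ((5.7) for `A_{□_j}`:
`B4Sect5Proof.inv_compress_decay`), for all `x, x′`. [cite: Balaban1983RegularityDecay, (5.7) p.594 & (5.12)] -/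
theorem abs_cOp_le (hγ : 0 < γ₀) (hc : 0 ≤ c₀) (hδ : 0 < δ₀) {A : Matrix (B4.Idx Λ N) (B4.Idx Λ N) ℝ}
    (hA : B4.Hyp56 Λ A γ₀ c₀ δ₀) (M : ℕ) (j : Fin d → ℤ) (p q : B4.Idx Λ N) :
    |cOp M A j p q| ≤
      2 / γ₀ * Real.exp (-(delta1 d N γ₀ c₀ δ₀ * dist (p.1 : Fin d → ℤ) (q.1 : Fin d → ℤ))) := by
  rw [cOp_apply]
  split_ifs with hp hq
  · exact inv_compress_decay hγ hc hδ hA (boxSet_subset M Λ j) (resIdx p hp) (resIdx q hq)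
  · rw [abs_zero]; positivity
  · rw [abs_zero]; positivity

/-- the uniform row-sum bound of the local inverses, `cRow = (2/γ₀)·N·K_d(δ₁)` (the print's *"‖C_{j′}‖ ≤ γ₀^{−1}"*,
p. 595, here in the `ℓ^∞` operator norm). [cite: Balaban1983RegularityDecay, p.595] -/
noncomputable def cRow (d N : ℕ) (γ₀ c₀ δ₀ : ℝ) : ℝ := 2 / γ₀ * (N * latticeConst d (delta1 d N γ₀ c₀ δ₀))

/-- `cRow ≥ 0`. [cite: Balaban1983RegularityDecay, p.595] -/
theorem cRow_nonneg (d N : ℕ) (hγ : 0 < γ₀) (hc : 0 ≤ c₀) (hδ : 0 < δ₀) : 0 ≤ cRow d N γ₀ c₀ δ₀ := by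
  unfold cRow
  have := latticeConst_nonneg d (delta1_pos d N hγ hc hδ).le
  positivity

/-- `Σ_{x′} |C_j(x,x′)| ≤ cRow`, uniformly. [cite: Balaban1983RegularityDecay, p.595] -/
theorem sum_abs_cOp_le (hγ : 0 < γ₀) (hc : 0 ≤ c₀) (hδ : 0 < δ₀) {A : Matrix (B4.Idx Λ N) (B4.Idx Λ N) ℝ}
    (hA : B4.Hyp56 Λ A γ₀ c₀ δ₀) (M : ℕ) (j : Fin d → ℤ) (p : B4.Idx Λ N) :
    ∑ q, |cOp M A j p q| ≤ cRow d N γ₀ c₀ δ₀ := by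
  set δ₁ := delta1 d N γ₀ c₀ δ₀ with hδ₁
  have hterm : ∀ q : B4.Idx Λ N, |cOp M A j p q| ≤
      if (q.1 : Fin d → ℤ) ∈ boxSet M Λ j then
        2 / γ₀ * Real.exp (-(δ₁ * dist (p.1 : Fin d → ℤ) (q.1 : Fin d → ℤ))) else 0 := by
    intro q
    split_ifs with hq
    · exact abs_cOp_le hγ hc hδ hA M j p q
    · rw [cOp_eq_zero_right A p (fun h => hq (mem_boxSet.mpr ⟨q.1.2, h⟩)), abs_zero]
  calc ∑ q, |cOp M A j p q|
      ≤ ∑ q : B4.Idx Λ N, (if (q.1 : Fin d → ℤ) ∈ boxSet M Λ j then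
          2 / γ₀ * Real.exp (-(δ₁ * dist (p.1 : Fin d → ℤ) (q.1 : Fin d → ℤ))) else 0) := Finset.sum_le_sum fun q _ => hterm q
    _ = ∑ k : B4.Idx (boxSet M Λ j) N, 2 / γ₀ * Real.exp (-(δ₁ * dist (p.1 : Fin d → ℤ) (k.1 : Fin d → ℤ))) :=
        (sum_inclIdx (boxSet_subset M Λ j)
          (fun q => 2 / γ₀ * Real.exp (-(δ₁ * dist (p.1 : Fin d → ℤ) (q.1 : Fin d → ℤ))))).symm
    _ = 2 / γ₀ * ∑ k : B4.Idx (boxSet M Λ j) N, Real.exp (-(δ₁ * dist (p.1 : Fin d → ℤ) (k.1 : Fin d → ℤ))) := by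
        rw [Finset.mul_sum]
    _ ≤ 2 / γ₀ * (N * latticeConst d δ₁) :=
        mul_le_mul_of_nonneg_left (idxSum_le (delta1_pos d N hγ hc hδ) _ _) (by positivity)

/-- `Σ_{x′} |A(x,x′)|·|x − x′| ≤ M₀` under the kernel bound of (5.6) (`weightedRowSum_le` at `κ = δ₀/4` and `κt ≤
e^{κt} − 1`). [cite: Balaban1983RegularityDecay, (5.6) p.594] -/
theorem sum_abs_mul_dist_le (hc : 0 ≤ c₀) (hδ : 0 < δ₀) (A : Matrix (B4.Idx Λ N) (B4.Idx Λ N) ℝ)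
    (hA : ∀ p q : B4.Idx Λ N,
      |A p q| ≤ c₀ * Real.exp (-(δ₀ * dist (p.1 : Fin d → ℤ) (q.1 : Fin d → ℤ))))
    (p : B4.Idx Λ N) :
    ∑ r, |A p r| * dist (p.1 : Fin d → ℤ) (r.1 : Fin d → ℤ) ≤ weightConst d N c₀ δ₀ := by
  have hκ : 0 < δ₀ / 4 := by positivity
  have h := weightedRowSum_le A hc hδ hκ.le le_rfl hA p
  have hterm : ∀ r : B4.Idx Λ N, δ₀ / 4 * (|A p r| * dist (p.1 : Fin d → ℤ) (r.1 : Fin d → ℤ)) ≤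
      |A p r| * (Real.exp (δ₀ / 4 * dist (p.1 : Fin d → ℤ) (r.1 : Fin d → ℤ)) - 1) := by
    intro r
    have h1 := Real.add_one_le_exp (δ₀ / 4 * dist (p.1 : Fin d → ℤ) (r.1 : Fin d → ℤ))
    rw [show δ₀ / 4 * (|A p r| * dist (p.1 : Fin d → ℤ) (r.1 : Fin d → ℤ)) =
      |A p r| * (δ₀ / 4 * dist (p.1 : Fin d → ℤ) (r.1 : Fin d → ℤ)) by ring]
    exact mul_le_mul_of_nonneg_left (by linarith) (abs_nonneg _)
  have h2 : δ₀ / 4 * ∑ r, |A p r| * dist (p.1 : Fin d → ℤ) (r.1 : Fin d → ℤ) ≤ δ₀ / 4 * weightConst d N c₀ δ₀ := by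
    rw [Finset.mul_sum]
    exact (Finset.sum_le_sum fun r _ => hterm r).trans h
  exact le_of_mul_le_mul_left h2 hκ

/-- the entries of `R = −Σ_j [A,h_j]C_jh_j`: `R(x,x′) = −Σ_j (Σ_r A(x,r)(h_j(r) − h_j(x))C_j(r,x′))h_j(x′)`. [cite:
Balaban1983RegularityDecay, (5.13)–(5.14) pp.594–595] -/
theorem rOp_apply (M : ℕ) (A : Matrix (B4.Idx Λ N) (B4.Idx Λ N) ℝ) (p q : B4.Idx Λ N) :
    rOp A (hFam N M Λ) (cFam M A) p q =
      -∑ j : ↥(labels M Λ), (∑ r, A p r * (hfun M j.1 r.1 - hfun M j.1 p.1) * cOp M A j.1 r q) * hfun M j.1 q.1 := by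
  unfold rOp hFam cFam
  rw [Matrix.neg_apply, Matrix.sum_apply]
  refine congrArg _ (Finset.sum_congr rfl fun j _ => ?_)
  rw [mul_mulH_apply, Matrix.mul_apply]
  simp_rw [comm_mulH_apply]

/-- `|R(x,x′)| ≤ (3πd/2M)·Σ_j Σ_r |A(x,r)|·|x − r|·|C_j(r,x′)|` (the first kernel estimate, summed over the cubes).
[cite: Balaban1983RegularityDecay, p.595] -/
theorem abs_rOp_apply_le {M : ℕ} (hM : 0 < M) (A : Matrix (B4.Idx Λ N) (B4.Idx Λ N) ℝ) (p q : B4.Idx Λ N) :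
    |rOp A (hFam N M Λ) (cFam M A) p q| ≤
      3 * π * d / (2 * M) * ∑ j : ↥(labels M Λ), ∑ r, |A p r| * dist (p.1 : Fin d → ℤ) (r.1 : Fin d → ℤ) *
        |cOp M A j.1 r q| := by
  rw [rOp_apply, abs_neg, Finset.mul_sum]
  refine (Finset.abs_sum_le_sum_abs _ _).trans (Finset.sum_le_sum fun j _ => ?_)
  rw [abs_mul, Finset.mul_sum]
  calc |∑ r, A p r * (hfun M j.1 r.1 - hfun M j.1 p.1) * cOp M A j.1 r q| * |hfun M j.1 q.1|
      ≤ |∑ r, A p r * (hfun M j.1 r.1 - hfun M j.1 p.1) * cOp M A j.1 r q| * 1 :=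
        mul_le_mul_of_nonneg_left (abs_hfun_le_one M _ _) (abs_nonneg _)
    _ ≤ ∑ r, |A p r * (hfun M j.1 r.1 - hfun M j.1 p.1) * cOp M A j.1 r q| := by
        rw [mul_one]; exact Finset.abs_sum_le_sum_abs _ _
    _ ≤ ∑ r, 3 * π * d / (2 * M) * (|A p r| * dist (p.1 : Fin d → ℤ) (r.1 : Fin d → ℤ) * |cOp M A j.1 r q|) := by
        refine Finset.sum_le_sum fun r _ => ?_
        rw [abs_mul, abs_mul]
        have hL := abs_hfun_sub_le hM j.1 (r.1 : Fin d → ℤ) (p.1 : Fin d → ℤ)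
        rw [dist_comm] at hL
        calc |A p r| * |hfun M j.1 r.1 - hfun M j.1 p.1| * |cOp M A j.1 r q|
            ≤ |A p r| * (3 * π * d / (2 * M) * dist (p.1 : Fin d → ℤ) (r.1 : Fin d → ℤ)) * |cOp M A j.1 r q| := by
              gcongr
          _ = _ := by ring

/-- `Σ_j Σ_{x′} |C_j(r,x′)| ≤ 2^d·cRow` (at most `2^d` cubes contain `r`). [cite: Balaban1983RegularityDecay, p.595;
p.578] -/
theorem sum_sum_abs_cOp_le (hγ : 0 < γ₀) (hc : 0 ≤ c₀) (hδ : 0 < δ₀) {A : Matrix (B4.Idx Λ N) (B4.Idx Λ N) ℝ}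
    (hA : B4.Hyp56 Λ A γ₀ c₀ δ₀) {M : ℕ} (hM : 0 < M) (r : B4.Idx Λ N) :
    ∑ j : ↥(labels M Λ), ∑ q, |cOp M A j.1 r q| ≤ 2 ^ d * cRow d N γ₀ c₀ δ₀ := by
  have hB := cRow_nonneg d N hγ hc hδ
  calc ∑ j : ↥(labels M Λ), ∑ q, |cOp M A j.1 r q|
      ≤ ∑ j : ↥(labels M Λ), (if InBox M j.1 (r.1 : Fin d → ℤ) then cRow d N γ₀ c₀ δ₀ else 0) := by
        refine Finset.sum_le_sum fun j _ => ?_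
        split_ifs with hj
        · exact sum_abs_cOp_le hγ hc hδ hA M j.1 r
        · rw [Finset.sum_eq_zero fun q _ => by rw [cOp_eq_zero_left A hj, abs_zero]]
    _ = ((labels M Λ).filter fun j => InBox M j (r.1 : Fin d → ℤ)).card * cRow d N γ₀ c₀ δ₀ := by
        rw [Finset.sum_coe_sort (labels M Λ) (fun j => if InBox M j (r.1 : Fin d → ℤ) then cRow d N γ₀ c₀ δ₀ else 0),
          ← Finset.sum_filter, Finset.sum_const, nsmul_eq_mul]
    _ ≤ 2 ^ d * cRow d N γ₀ c₀ δ₀ := by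
        apply mul_le_mul_of_nonneg_right _ hB
        exact_mod_cast card_filter_inBox_le hM (labels M Λ) (r.1 : Fin d → ℤ)

/-- the smallness constant of `R`: `K_R = (3πd/2)·2^d·cRow·M₀`, with `sup_x Σ_{x′}|R(x,x′)| ≤ K_R/M` (*"‖R‖ … is
small for M large"*, p. 595). [cite: Balaban1983RegularityDecay, p.595] -/
noncomputable def kR (d N : ℕ) (γ₀ c₀ δ₀ : ℝ) : ℝ :=
  3 * π * d / 2 * (2 ^ d * cRow d N γ₀ c₀ δ₀) * weightConst d N c₀ δ₀

/-- `K_R ≥ 0`. [cite: Balaban1983RegularityDecay, p.595] -/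
theorem kR_nonneg (d N : ℕ) (hγ : 0 < γ₀) (hc : 0 ≤ c₀) (hδ : 0 < δ₀) : 0 ≤ kR d N γ₀ c₀ δ₀ := by
  unfold kR
  have := cRow_nonneg d N hγ hc hδ
  have := weightConst_nonneg d N hc hδ
  positivity

/-- **row sums of `R`**: `Σ_{x′} |R(x,x′)| ≤ K_R/M`. [cite: Balaban1983RegularityDecay, p.595] -/
theorem sum_abs_rOp_le (hγ : 0 < γ₀) (hc : 0 ≤ c₀) (hδ : 0 < δ₀) {A : Matrix (B4.Idx Λ N) (B4.Idx Λ N) ℝ}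
    (hA : B4.Hyp56 Λ A γ₀ c₀ δ₀) {M : ℕ} (hM : 0 < M) (p : B4.Idx Λ N) :
    ∑ q, |rOp A (hFam N M Λ) (cFam M A) p q| ≤ kR d N γ₀ c₀ δ₀ / M := by
  have hMr : (0 : ℝ) < M := by exact_mod_cast hM
  set L : ℝ := 3 * π * d / (2 * M) with hL
  have hL0 : 0 ≤ L := by positivity
  set a : B4.Idx Λ N → ℝ := fun r => |A p r| * dist (p.1 : Fin d → ℤ) (r.1 : Fin d → ℤ) with ha
  have ha0 : ∀ r, 0 ≤ a r := fun r => mul_nonneg (abs_nonneg _) dist_nonneg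
  calc ∑ q, |rOp A (hFam N M Λ) (cFam M A) p q|
      ≤ ∑ q, L * ∑ j : ↥(labels M Λ), ∑ r, a r * |cOp M A j.1 r q| :=
        Finset.sum_le_sum fun q _ => abs_rOp_apply_le hM A p q
    _ = L * ∑ j : ↥(labels M Λ), ∑ r, a r * ∑ q, |cOp M A j.1 r q| := by
        rw [← Finset.mul_sum, Finset.sum_comm]
        congr 1
        refine Finset.sum_congr rfl fun j _ => ?_
        rw [Finset.sum_comm]
        refine Finset.sum_congr rfl fun r _ => ?_
        rw [Finset.mul_sum]
    _ = L * ∑ r, a r * ∑ j : ↥(labels M Λ), ∑ q, |cOp M A j.1 r q| := by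
        congr 1
        rw [Finset.sum_comm]
        refine Finset.sum_congr rfl fun r _ => ?_
        rw [Finset.mul_sum]
    _ ≤ L * ∑ r, a r * (2 ^ d * cRow d N γ₀ c₀ δ₀) := by
        gcongr with r
        exact sum_sum_abs_cOp_le hγ hc hδ hA hM _
    _ = L * (2 ^ d * cRow d N γ₀ c₀ δ₀) * ∑ r, a r := by rw [← Finset.sum_mul]; ring
    _ ≤ L * (2 ^ d * cRow d N γ₀ c₀ δ₀) * weightConst d N c₀ δ₀ := by
        have := cRow_nonneg d N hγ hc hδ
        exact mul_le_mul_of_nonneg_left (sum_abs_mul_dist_le hc hδ A hA.2.2 p) (by positivity)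
    _ = kR d N γ₀ c₀ δ₀ / M := by rw [hL, kR]; field_simp

/-- a uniform absolute row-sum bound bounds the `ℓ^∞` operator norm (`Matrix.linftyOpNormedRing`) — the tree's form
of the printed line *"‖R‖ ≤ max{sup_jΣ_{j′}‖R_{j,j′}‖, sup_{j′}Σ_j‖R_{j,j′}‖}…"* (p. 595). [cite:
Balaban1983RegularityDecay, p.595] -/
theorem linfty_opNorm_le_of_rows {n : Type*} [Fintype n] (B : Matrix n n ℝ) {c : ℝ} (hc : 0 ≤ c)
    (h : ∀ i, ∑ j, |B i j| ≤ c) : ‖B‖ ≤ c := by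
  rw [Matrix.linfty_opNorm_def]
  have : ∀ i, (∑ j, ‖B i j‖₊ : NNReal) ≤ ⟨c, hc⟩ := fun i => by
    rw [← NNReal.coe_le_coe]; push_cast
    have e : ∀ j, ‖B i j‖ = |B i j| := fun j => Real.norm_eq_abs _
    simp only [e]
    exact h i
  exact_mod_cast Finset.sup_le fun i _ => this i

/-- **`‖R‖ ≤ K_R/M`** (`ℓ^∞` operator norm) — *"‖R‖ … is small for M large"* (p. 595). [cite:
Balaban1983RegularityDecay, p.595] -/
theorem norm_rOp_le (hγ : 0 < γ₀) (hc : 0 ≤ c₀) (hδ : 0 < δ₀) {A : Matrix (B4.Idx Λ N) (B4.Idx Λ N) ℝ}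
    (hA : B4.Hyp56 Λ A γ₀ c₀ δ₀) {M : ℕ} (hM : 0 < M) :
    ‖rOp A (hFam N M Λ) (cFam M A)‖ ≤ kR d N γ₀ c₀ δ₀ / M :=
  linfty_opNorm_le_of_rows _ (div_nonneg (kR_nonneg d N hγ hc hδ) (Nat.cast_nonneg M))
    (sum_abs_rOp_le hγ hc hδ hA hM)

/-! ## §6 (5.16) on the lattice: `A_Λ^{−1} = Σ_n CRⁿ` for `M > K_R` -/

/-- **(5.16) ON THE LATTICE, from (5.6) alone** p. 595: *"C_Λ = C(I−R)^{−1} = Σ_{n=0}^∞ CRⁿ"* — for cubes of size `M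
> K_R(d,N,γ₀,c₀,δ₀)`, `HasSum (n ↦ CRⁿ) A_Λ^{−1}` (`B4Sect5RandomWalk.hasSum516` instantiated). [cite:
Balaban1983RegularityDecay, (5.16) p.595] -/
theorem hasSum516_lattice (hγ : 0 < γ₀) (hc : 0 ≤ c₀) (hδ : 0 < δ₀) {A : Matrix (B4.Idx Λ N) (B4.Idx Λ N) ℝ}
    (hA : B4.Hyp56 Λ A γ₀ c₀ δ₀) {M : ℕ} (hM : kR d N γ₀ c₀ δ₀ < M) :
    HasSum (fun n : ℕ => cPar (hFam N M Λ) (cFam M A) * rOp A (hFam N M Λ) (cFam M A) ^ n) A⁻¹ := by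
  have hM0 : 0 < M := by
    have := kR_nonneg d N hγ hc hδ
    exact_mod_cast this.trans_lt hM
  have hMr : (0 : ℝ) < M := by exact_mod_cast hM0
  refine hasSum516 (cubeSystem_lattice hM0 hγ hc hδ.le hA) (Matrix.nonsing_inv_mul A ?_) ?_
  · exact (Matrix.isUnit_iff_isUnit_det _).mp (isUnit_of_hyp56 hγ hA)
  · exact (norm_rOp_le hγ hc hδ hA hM0).trans_lt (by rwa [div_lt_one hMr])

end Entries

/-! ## §7 The two kernel estimates of p. 595 and (5.15) -/

section PairBounds

open Literature.MathematicalPhysics.QuantumFieldTheory.Balaban1983to89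
open B4Commutators25to211 B4GaugeCovariance B4Sect5RandomWalk B4Sect5Proof B6GOmega
open scoped Matrix Matrix.Norms.Operator

variable {N : ℕ} {Λ : Finset (Fin d → ℤ)} {γ₀ c₀ δ₀ : ℝ}

/-- the indicator `□_j(x)`. [cite: Balaban1983RegularityDecay, (5.11) p.594] -/
theorem boxInd_eq (M : ℕ) (j : ↥(labels M Λ)) (x : ↥Λ) :
    boxInd (fun j' : ↥(labels M Λ) => box M Λ j'.1) j x = if InBox M j.1 (x : Fin d → ℤ) then 1 else 0 := by
  simp only [boxInd, mem_box]

/-- `0 ≤ □_j(x)`. [cite: Balaban1983RegularityDecay, (5.11) p.594] -/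
theorem boxInd_nonneg (M : ℕ) (j : ↥(labels M Λ)) (x : ↥Λ) :
    0 ≤ boxInd (fun j' : ↥(labels M Λ) => box M Λ j'.1) j x := by
  unfold boxInd; split_ifs <;> norm_num

/-- `□_j(x) ≤ 1`. [cite: Balaban1983RegularityDecay, (5.11) p.594] -/
theorem boxInd_le_one (M : ℕ) (j : ↥(labels M Λ)) (x : ↥Λ) :
    boxInd (fun j' : ↥(labels M Λ) => box M Λ j'.1) j x ≤ 1 := by
  unfold boxInd; split_ifs <;> norm_num

/-- `1 − mulH g = mulH (1 − g)` (the print's `1 − □_{j′}` in (5.13)–(5.14)). [cite: Balaban1983RegularityDecay,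
(5.14) p.595] -/
theorem one_sub_mulH {X ι : Type*} [Fintype X] [Fintype ι] [DecidableEq X] [DecidableEq ι] (g : X → ℝ) :
    (1 : Matrix (X × ι) (X × ι) ℝ) - mulH (ι := ι) g = mulH (ι := ι) (fun x => 1 - g x) := by
  ext p q
  rw [Matrix.sub_apply, mulH_apply, mulH_apply, Matrix.one_apply]
  split_ifs <;> simp

/-- entries of `R_{j,j} = −□_j[A,h_j]□_j`: `−□_j(x)A(x,x′)(h_j(x′) − h_j(x))□_j(x′)`. [cite:
Balaban1983RegularityDecay, (5.14) p.595] -/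
theorem rPair_diag_apply (M : ℕ) (A : Matrix (B4.Idx Λ N) (B4.Idx Λ N) ℝ) (j : ↥(labels M Λ))
    (p q : B4.Idx Λ N) :
    rPair A (pFam N M Λ) (hFam N M Λ) j j p q =
      -(boxInd (fun j' : ↥(labels M Λ) => box M Λ j'.1) j p.1 * (A p q * (hfun M j.1 q.1 - hfun M j.1 p.1)) *
        boxInd (fun j' : ↥(labels M Λ) => box M Λ j'.1) j q.1) := by
  rw [rPair, if_pos rfl, Matrix.neg_apply]
  simp only [pFam, hFam]
  rw [mul_mulH_apply, mulH_mul_apply, comm_mulH_apply]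

/-- entries of `R_{j,j′} = −(1−□_{j′})h_j²Ah_{j′}`, `j ≠ j′`: *"(1−□_{j′})(x)h²_j(x)A(x,x′)h_{j′}(x′)"* (with the
sign). [cite: Balaban1983RegularityDecay, (5.14) p.595] -/
theorem rPair_offDiag_apply (M : ℕ) (A : Matrix (B4.Idx Λ N) (B4.Idx Λ N) ℝ) {j j' : ↥(labels M Λ)}
    (hjj' : j ≠ j') (p q : B4.Idx Λ N) :
    rPair A (pFam N M Λ) (hFam N M Λ) j j' p q =
      -((1 - boxInd (fun i : ↥(labels M Λ) => box M Λ i.1) j' p.1) * (hfun M j.1 p.1 * hfun M j.1 p.1) *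
        A p q * hfun M j'.1 q.1) := by
  rw [rPair, if_neg hjj', Matrix.neg_apply]
  simp only [pFam, hFam]
  rw [one_sub_mulH, mulH_mul_mulH, mulH_mul_mulH, mul_mulH_apply, mulH_mul_apply]

/-- **FIRST KERNEL ESTIMATE** p. 595 [PDF 25], verbatim: *"|R_{j,j}(x,x′)| = |A(x,x′)(h_j(x′) − h_j(x))| ≤
c₀e^{−δ₀|x−x′|}O(1)|x−x′|/M, x, x′ ∈ □_j"* — here with `O(1) = 3πd/2` (the Lipschitz constant of the profile), first
with `|A(x,x′)|` kept: `|R_{j,j}(x,x′)| ≤ |A(x,x′)|·(3πd/2M)|x − x′|` for all `x, x′`. [cite: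
Balaban1983RegularityDecay, p.595 (display after (5.14))] -/
theorem abs_rPair_diag_le {M : ℕ} (hM : 0 < M) (A : Matrix (B4.Idx Λ N) (B4.Idx Λ N) ℝ) (j : ↥(labels M Λ))
    (p q : B4.Idx Λ N) :
    |rPair A (pFam N M Λ) (hFam N M Λ) j j p q| ≤
      |A p q| * (3 * π * d / (2 * M) * dist (p.1 : Fin d → ℤ) (q.1 : Fin d → ℤ)) := by
  rw [rPair_diag_apply, abs_neg, abs_mul, abs_mul, abs_mul, abs_of_nonneg (boxInd_nonneg M j p.1),
    abs_of_nonneg (boxInd_nonneg M j q.1)]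
  have hL := abs_hfun_sub_le hM j.1 (q.1 : Fin d → ℤ) (p.1 : Fin d → ℤ)
  rw [dist_comm] at hL
  have h1 := boxInd_le_one M j p.1
  have h2 := boxInd_le_one M j q.1
  have h3 := boxInd_nonneg M j p.1
  have h4 := boxInd_nonneg M j q.1
  calc boxInd (fun j' : ↥(labels M Λ) => box M Λ j'.1) j p.1 * (|A p q| * |hfun M j.1 q.1 - hfun M j.1 p.1|) *
        boxInd (fun j' : ↥(labels M Λ) => box M Λ j'.1) j q.1
      ≤ 1 * (|A p q| * (3 * π * d / (2 * M) * dist (p.1 : Fin d → ℤ) (q.1 : Fin d → ℤ))) * 1 := by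
        gcongr
    _ = _ := by ring

/-- the first kernel estimate in its printed form, under (5.6): `|R_{j,j}(x,x′)| ≤ c₀e^{−δ₀|x−x′|}(3πd/2)|x−x′|/M`.
[cite: Balaban1983RegularityDecay, p.595 (display after (5.14))] -/
theorem abs_rPair_diag_le' {M : ℕ} (hM : 0 < M) {A : Matrix (B4.Idx Λ N) (B4.Idx Λ N) ℝ}
    (hA : ∀ p q : B4.Idx Λ N,
      |A p q| ≤ c₀ * Real.exp (-(δ₀ * dist (p.1 : Fin d → ℤ) (q.1 : Fin d → ℤ))))
    (j : ↥(labels M Λ)) (p q : B4.Idx Λ N) :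
    |rPair A (pFam N M Λ) (hFam N M Λ) j j p q| ≤
      c₀ * Real.exp (-(δ₀ * dist (p.1 : Fin d → ℤ) (q.1 : Fin d → ℤ))) *
        (3 * π * d / 2) * dist (p.1 : Fin d → ℤ) (q.1 : Fin d → ℤ) / M := by
  refine (abs_rPair_diag_le hM A j p q).trans ?_
  have hMr : (0 : ℝ) < M := by exact_mod_cast hM
  calc |A p q| * (3 * π * d / (2 * M) * dist (p.1 : Fin d → ℤ) (q.1 : Fin d → ℤ))
      ≤ c₀ * Real.exp (-(δ₀ * dist (p.1 : Fin d → ℤ) (q.1 : Fin d → ℤ))) *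
        (3 * π * d / (2 * M) * dist (p.1 : Fin d → ℤ) (q.1 : Fin d → ℤ)) :=
        mul_le_mul_of_nonneg_right (hA p q) (by positivity)
    _ = _ := by field_simp

/-- **SECOND KERNEL ESTIMATE, first inequality** p. 595, verbatim: *"|R_{j,j′}(x,x′)| =
|(1−□_{j′})(x)h²_j(x)A(x,x′)h_{j′}(x′)| ≤ (1−□_{j′}(x))c₀e^{−δ₀|x−x′|}h_{j′}(x′)"* (`j ≠ j′`).
[cite: Balaban1983RegularityDecay, p.595 (display after (5.14))] -/
theorem abs_rPair_offDiag_le (M : ℕ) {A : Matrix (B4.Idx Λ N) (B4.Idx Λ N) ℝ}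
    (hA : ∀ p q : B4.Idx Λ N,
      |A p q| ≤ c₀ * Real.exp (-(δ₀ * dist (p.1 : Fin d → ℤ) (q.1 : Fin d → ℤ))))
    {j j' : ↥(labels M Λ)} (hjj' : j ≠ j') (p q : B4.Idx Λ N) :
    |rPair A (pFam N M Λ) (hFam N M Λ) j j' p q| ≤
      (1 - boxInd (fun i : ↥(labels M Λ) => box M Λ i.1) j' p.1) *
        (c₀ * Real.exp (-(δ₀ * dist (p.1 : Fin d → ℤ) (q.1 : Fin d → ℤ)))) * hfun M j'.1 q.1 := by
  have h0 : 0 ≤ 1 - boxInd (fun i : ↥(labels M Λ) => box M Λ i.1) j' p.1 := by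
    have := boxInd_le_one M j' p.1; linarith
  have hf0 := hfun_nonneg M j'.1 (q.1 : Fin d → ℤ)
  rw [rPair_offDiag_apply M A hjj', abs_neg, abs_mul, abs_mul, abs_mul, abs_of_nonneg h0, abs_of_nonneg hf0]
  have hsq : |hfun M j.1 p.1 * hfun M j.1 p.1| ≤ 1 := by
    rw [abs_mul, abs_of_nonneg (hfun_nonneg M j.1 _)]
    exact mul_le_one₀ (hfun_le_one M j.1 _) (hfun_nonneg M j.1 _) (hfun_le_one M j.1 _)
  calc (1 - boxInd (fun i : ↥(labels M Λ) => box M Λ i.1) j' p.1) * |hfun M j.1 p.1 * hfun M j.1 p.1| * |A p q| *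
        hfun M j'.1 q.1
      ≤ (1 - boxInd (fun i : ↥(labels M Λ) => box M Λ i.1) j' p.1) * 1 *
        (c₀ * Real.exp (-(δ₀ * dist (p.1 : Fin d → ℤ) (q.1 : Fin d → ℤ)))) * hfun M j'.1 q.1 := by
        gcongr
        exact hA p q
    _ = _ := by ring

/-- **SECOND KERNEL ESTIMATE, second inequality** p. 595, verbatim: *"≤ c₀e^{−½δ₀|x−x′|}e^{−(1/6)δ₀M} for x ∈ □_j,
x′ ∈ □_{j′}"* — because `x ∉ □_{j′}` and `x′ ∈ supp h_{j′}` force `|x − x′| ≥ M/3` (`dist_ge_of_not_inBox`); valid for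
all `x, x′`. [cite: Balaban1983RegularityDecay, p.595 (display after (5.14))] -/
theorem abs_rPair_offDiag_le' {M : ℕ} (hM : 0 < M) (hc : 0 ≤ c₀) (hδ : 0 ≤ δ₀)
    {A : Matrix (B4.Idx Λ N) (B4.Idx Λ N) ℝ}
    (hA : ∀ p q : B4.Idx Λ N,
      |A p q| ≤ c₀ * Real.exp (-(δ₀ * dist (p.1 : Fin d → ℤ) (q.1 : Fin d → ℤ))))
    {j j' : ↥(labels M Λ)} (hjj' : j ≠ j') (p q : B4.Idx Λ N) :
    |rPair A (pFam N M Λ) (hFam N M Λ) j j' p q| ≤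
      c₀ * Real.exp (-(δ₀ / 2 * dist (p.1 : Fin d → ℤ) (q.1 : Fin d → ℤ))) * Real.exp (-(δ₀ / 6 * M)) := by
  refine (abs_rPair_offDiag_le M hA hjj' p q).trans ?_
  by_cases hp : InBox M j'.1 (p.1 : Fin d → ℤ)
  · rw [boxInd_eq, if_pos hp, sub_self, zero_mul, zero_mul]; positivity
  · by_cases hq : hfun M j'.1 (q.1 : Fin d → ℤ) = 0
    · rw [hq, mul_zero]; positivity
    · have hd := dist_ge_of_not_inBox hM hp hq
      rw [boxInd_eq, if_neg hp, sub_zero, one_mul]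
      calc c₀ * Real.exp (-(δ₀ * dist (p.1 : Fin d → ℤ) (q.1 : Fin d → ℤ))) * hfun M j'.1 q.1
          ≤ c₀ * Real.exp (-(δ₀ * dist (p.1 : Fin d → ℤ) (q.1 : Fin d → ℤ))) * 1 := by
            gcongr; exact hfun_le_one M _ _
        _ = c₀ * (Real.exp (-(δ₀ / 2 * dist (p.1 : Fin d → ℤ) (q.1 : Fin d → ℤ))) *
              Real.exp (-(δ₀ / 2 * dist (p.1 : Fin d → ℤ) (q.1 : Fin d → ℤ)))) := by
            rw [mul_one, ← Real.exp_add]; ring_nf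
        _ ≤ c₀ * (Real.exp (-(δ₀ / 2 * dist (p.1 : Fin d → ℤ) (q.1 : Fin d → ℤ))) * Real.exp (-(δ₀ / 6 * M))) := by
            gcongr c₀ * (_ * ?_)
            apply Real.exp_le_exp.mpr
            nlinarith
        _ = _ := by ring

/-- distinct points of `ℤ^d` are at sup-distance `≥ 1`. [folklore] (bookkeeping for Bałaban, CMP **89**, Sect. 5) -/
private theorem one_le_dist_of_ne {j j' : Fin d → ℤ} (h : j ≠ j') : 1 ≤ dist j j' := by
  obtain ⟨μ, hμ⟩ := Function.ne_iff.mp h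
  have h1 : (1 : ℝ) ≤ dist (j μ) (j' μ) := by
    rw [Int.dist_eq]
    have : (1 : ℤ) ≤ |j μ - j' μ| := Int.one_le_abs (sub_ne_zero.mpr hμ)
    exact_mod_cast this
  exact h1.trans (dist_le_pi_dist j j' μ)

/-- the geometry behind (5.15): a non-zero entry `R_{j,j′}(x,x′)`, `j ≠ j′`, has `|x − x′| ≥ M|j − j′|/5` (from the
margin `M/3` and the support separation `M(|j−j′| − 4/3)`). [cite: Balaban1983RegularityDecay, (5.15) p.595] -/
theorem dist_ge_of_entry_ne_zero {M : ℕ} (hM : 0 < M) {j j' : Fin d → ℤ} {x x' : Fin d → ℤ}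
    (hx : hfun M j x ≠ 0) (hbox : ¬ InBox M j' x) (hx' : hfun M j' x' ≠ 0) :
    (M : ℝ) * dist j j' / 5 ≤ dist x x' := by
  have h1 := dist_ge_of_not_inBox hM hbox hx'
  have h2 := dist_ge_of_hfun_ne_zero hM hx hx'
  have hMr : (0 : ℝ) < M := by exact_mod_cast hM
  nlinarith

/-- entries of `R_{j,j′}`, `j ≠ j′`, decay in `|x − x′|` AND in `|j − j′|`: `|R_{j,j′}(x,x′)| ≤
c₀e^{−¼δ₀|x−x′|}e^{−(3/20)δ₀M|j−j′|}`. [cite: Balaban1983RegularityDecay, (5.15) p.595] -/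
theorem abs_rPair_offDiag_le'' {M : ℕ} (hM : 0 < M) (hc : 0 ≤ c₀) (hδ : 0 ≤ δ₀)
    {A : Matrix (B4.Idx Λ N) (B4.Idx Λ N) ℝ}
    (hA : ∀ p q : B4.Idx Λ N,
      |A p q| ≤ c₀ * Real.exp (-(δ₀ * dist (p.1 : Fin d → ℤ) (q.1 : Fin d → ℤ))))
    {j j' : ↥(labels M Λ)} (hjj' : j ≠ j') (p q : B4.Idx Λ N) :
    |rPair A (pFam N M Λ) (hFam N M Λ) j j' p q| ≤
      c₀ * Real.exp (-(δ₀ / 4 * dist (p.1 : Fin d → ℤ) (q.1 : Fin d → ℤ))) *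
        Real.exp (-(3 * δ₀ / 20 * M * dist (j.1 : Fin d → ℤ) (j'.1 : Fin d → ℤ))) := by
  by_cases hfp : hfun M j.1 (p.1 : Fin d → ℤ) = 0
  · rw [rPair_offDiag_apply M A hjj', hfp]; simp only [mul_zero, zero_mul, neg_zero, abs_zero]; positivity
  by_cases hp : InBox M j'.1 (p.1 : Fin d → ℤ)
  · rw [rPair_offDiag_apply M A hjj', boxInd_eq, if_pos hp]; simp only [sub_self, zero_mul, neg_zero, abs_zero]
    positivity
  by_cases hq : hfun M j'.1 (q.1 : Fin d → ℤ) = 0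
  · rw [rPair_offDiag_apply M A hjj', hq]; simp only [mul_zero, neg_zero, abs_zero]; positivity
  have hd := dist_ge_of_entry_ne_zero hM hfp hp hq
  refine (abs_rPair_offDiag_le M hA hjj' p q).trans ?_
  rw [boxInd_eq, if_neg hp, sub_zero, one_mul]
  calc c₀ * Real.exp (-(δ₀ * dist (p.1 : Fin d → ℤ) (q.1 : Fin d → ℤ))) * hfun M j'.1 q.1
      ≤ c₀ * Real.exp (-(δ₀ * dist (p.1 : Fin d → ℤ) (q.1 : Fin d → ℤ))) * 1 := by
        gcongr; exact hfun_le_one M _ _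
    _ = c₀ * (Real.exp (-(δ₀ / 4 * dist (p.1 : Fin d → ℤ) (q.1 : Fin d → ℤ))) *
          Real.exp (-(3 * δ₀ / 4 * dist (p.1 : Fin d → ℤ) (q.1 : Fin d → ℤ)))) := by
        rw [mul_one, ← Real.exp_add]; ring_nf
    _ ≤ c₀ * (Real.exp (-(δ₀ / 4 * dist (p.1 : Fin d → ℤ) (q.1 : Fin d → ℤ))) *
          Real.exp (-(3 * δ₀ / 20 * M * dist (j.1 : Fin d → ℤ) (j'.1 : Fin d → ℤ)))) := by
        gcongr c₀ * (_ * ?_)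
        apply Real.exp_le_exp.mpr
        nlinarith
    _ = _ := by ring

/-- **(5.15), diagonal pairs** (`ℓ^∞` operator norm): `‖R_{j,j}‖ ≤ (3πd/2M)·M₀`. [cite: Balaban1983RegularityDecay,
(5.15) p.595] -/
theorem norm_rPair_diag_le {M : ℕ} (hM : 0 < M) (hc : 0 ≤ c₀) (hδ : 0 < δ₀)
    {A : Matrix (B4.Idx Λ N) (B4.Idx Λ N) ℝ}
    (hA : ∀ p q : B4.Idx Λ N,
      |A p q| ≤ c₀ * Real.exp (-(δ₀ * dist (p.1 : Fin d → ℤ) (q.1 : Fin d → ℤ))))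
    (j : ↥(labels M Λ)) :
    ‖rPair A (pFam N M Λ) (hFam N M Λ) j j‖ ≤ 3 * π * d / (2 * M) * weightConst d N c₀ δ₀ := by
  have hW := weightConst_nonneg d N hc hδ
  refine linfty_opNorm_le_of_rows _ (by positivity) fun p => ?_
  calc ∑ q, |rPair A (pFam N M Λ) (hFam N M Λ) j j p q|
      ≤ ∑ q, 3 * π * d / (2 * M) * (|A p q| * dist (p.1 : Fin d → ℤ) (q.1 : Fin d → ℤ)) :=
        Finset.sum_le_sum fun q _ => (abs_rPair_diag_le hM A j p q).trans (le_of_eq (by ring))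
    _ ≤ 3 * π * d / (2 * M) * weightConst d N c₀ δ₀ := by
        rw [← Finset.mul_sum]
        exact mul_le_mul_of_nonneg_left (sum_abs_mul_dist_le hc hδ A hA p) (by positivity)

/-- **(5.15), off-diagonal pairs** (`ℓ^∞` operator norm): `‖R_{j,j′}‖ ≤ c₀NK_d(δ₀/4)·e^{−(3/20)δ₀M|j−j′|}`, `j ≠
j′`. [cite: Balaban1983RegularityDecay, (5.15) p.595] -/
theorem norm_rPair_offDiag_le {M : ℕ} (hM : 0 < M) (hc : 0 ≤ c₀) (hδ : 0 < δ₀)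
    {A : Matrix (B4.Idx Λ N) (B4.Idx Λ N) ℝ}
    (hA : ∀ p q : B4.Idx Λ N,
      |A p q| ≤ c₀ * Real.exp (-(δ₀ * dist (p.1 : Fin d → ℤ) (q.1 : Fin d → ℤ))))
    {j j' : ↥(labels M Λ)} (hjj' : j ≠ j') :
    ‖rPair A (pFam N M Λ) (hFam N M Λ) j j'‖ ≤
      c₀ * (N * latticeConst d (δ₀ / 4)) *
        Real.exp (-(3 * δ₀ / 20 * M * dist (j.1 : Fin d → ℤ) (j'.1 : Fin d → ℤ))) := by
  have hK := latticeConst_nonneg d (by positivity : (0:ℝ) ≤ δ₀ / 4)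
  refine linfty_opNorm_le_of_rows _ (by positivity) fun p => ?_
  calc ∑ q, |rPair A (pFam N M Λ) (hFam N M Λ) j j' p q|
      ≤ ∑ q : B4.Idx Λ N, c₀ * Real.exp (-(δ₀ / 4 * dist (p.1 : Fin d → ℤ) (q.1 : Fin d → ℤ))) *
          Real.exp (-(3 * δ₀ / 20 * M * dist (j.1 : Fin d → ℤ) (j'.1 : Fin d → ℤ))) :=
        Finset.sum_le_sum fun q _ => abs_rPair_offDiag_le'' hM hc hδ.le hA hjj' p q
    _ = c₀ * Real.exp (-(3 * δ₀ / 20 * M * dist (j.1 : Fin d → ℤ) (j'.1 : Fin d → ℤ))) *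
          ∑ q : B4.Idx Λ N, Real.exp (-(δ₀ / 4 * dist (p.1 : Fin d → ℤ) (q.1 : Fin d → ℤ))) := by
        rw [Finset.mul_sum]; refine Finset.sum_congr rfl fun q _ => ?_; ring
    _ ≤ c₀ * Real.exp (-(3 * δ₀ / 20 * M * dist (j.1 : Fin d → ℤ) (j'.1 : Fin d → ℤ))) *
          (N * latticeConst d (δ₀ / 4)) :=
        mul_le_mul_of_nonneg_left (idxSum_le (by positivity) Λ _) (by positivity)
    _ = _ := by ring

/-- the constant `α` of (5.15) — "depending on M and arbitrarily small if M is sufficiently large":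
`α(M) = (3πd/2M)·M₀ + c₀·N·K_d(δ₀/4)·e^{−δ₀M/10}`. [cite: Balaban1983RegularityDecay, (5.15) p.595] -/
noncomputable def alpha515 (d N : ℕ) (c₀ δ₀ : ℝ) (M : ℕ) : ℝ :=
  3 * π * d / (2 * M) * weightConst d N c₀ δ₀ + c₀ * (N * latticeConst d (δ₀ / 4)) * Real.exp (-(δ₀ / 10 * M))

/-- `α(M) ≥ 0`. [cite: Balaban1983RegularityDecay, (5.15) p.595] -/
theorem alpha515_nonneg (d N : ℕ) (hc : 0 ≤ c₀) (hδ : 0 < δ₀) (M : ℕ) : 0 ≤ alpha515 d N c₀ δ₀ M := by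
  unfold alpha515
  have hW := weightConst_nonneg d N hc hδ
  have hK := latticeConst_nonneg d (by positivity : (0:ℝ) ≤ δ₀ / 4)
  positivity

/-- **(5.15) PROVED** p. 595 [PDF 25], verbatim: *"and these estimates imply that the norms of the operators R_{j,j′}
have bounds ‖R_{j,j′}‖ ≤ αe^{−δ₂|j−j′|} (5.15) for α depending on M and arbitrarily small if M is sufficiently large,
δ₂ depending on δ₀, e.g. δ₂ = ¼δ₀."* — here in the `ℓ^∞` operator norm of `L²(Λ; ℝ^N)` (max row sum; the print's
norm is the `L²` operator norm), with `α = alpha515 d N c₀ δ₀ M`, `δ₂ = ¼δ₀`, for cubes of size `M ≥ 5`, under the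
kernel bound of (5.6). [cite: Balaban1983RegularityDecay, (5.15) p.595] -/
theorem ineq515 {M : ℕ} (hM : 5 ≤ M) (hc : 0 ≤ c₀) (hδ : 0 < δ₀) {A : Matrix (B4.Idx Λ N) (B4.Idx Λ N) ℝ}
    (hA : ∀ p q : B4.Idx Λ N,
      |A p q| ≤ c₀ * Real.exp (-(δ₀ * dist (p.1 : Fin d → ℤ) (q.1 : Fin d → ℤ))))
    (j j' : ↥(labels M Λ)) :
    ‖rPair A (pFam N M Λ) (hFam N M Λ) j j'‖ ≤
      alpha515 d N c₀ δ₀ M * Real.exp (-(δ₀ / 4 * dist (j.1 : Fin d → ℤ) (j'.1 : Fin d → ℤ))) := by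
  have hM0 : 0 < M := by omega
  have hMr : (5 : ℝ) ≤ M := by exact_mod_cast hM
  have hW := weightConst_nonneg d N hc hδ
  have hK := latticeConst_nonneg d (by positivity : (0:ℝ) ≤ δ₀ / 4)
  by_cases hjj' : j = j'
  · subst hjj'
    rw [dist_self, mul_zero, neg_zero, Real.exp_zero, mul_one]
    refine (norm_rPair_diag_le hM0 hc hδ hA j).trans ?_
    unfold alpha515
    have : 0 ≤ c₀ * (N * latticeConst d (δ₀ / 4)) * Real.exp (-(δ₀ / 10 * M)) := by positivity
    linarith
  · have hne : (j.1 : Fin d → ℤ) ≠ j'.1 := fun e => hjj' (Subtype.ext e)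
    have h1 := one_le_dist_of_ne hne
    refine (norm_rPair_offDiag_le hM0 hc hδ hA hjj').trans ?_
    set n := dist (j.1 : Fin d → ℤ) (j'.1 : Fin d → ℤ) with hn
    -- e^{−(3/20)δ₀Mn} ≤ e^{−δ₀M/10}·e^{−¼δ₀n}  (n ≥ 1, M ≥ 5)
    have hsplit : Real.exp (-(3 * δ₀ / 20 * M * n)) ≤ Real.exp (-(δ₀ / 10 * M)) * Real.exp (-(δ₀ / 4 * n)) := by
      rw [← Real.exp_add]
      apply Real.exp_le_exp.mpr
      nlinarith [mul_nonneg (mul_nonneg hδ.le (Nat.cast_nonneg M)) (sub_nonneg.mpr h1),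
        mul_nonneg (mul_nonneg hδ.le (by linarith : (0:ℝ) ≤ n)) (sub_nonneg.mpr hMr)]
    calc c₀ * (N * latticeConst d (δ₀ / 4)) * Real.exp (-(3 * δ₀ / 20 * M * n))
        ≤ c₀ * (N * latticeConst d (δ₀ / 4)) * (Real.exp (-(δ₀ / 10 * M)) * Real.exp (-(δ₀ / 4 * n))) :=
          mul_le_mul_of_nonneg_left hsplit (by positivity)
      _ = c₀ * (N * latticeConst d (δ₀ / 4)) * Real.exp (-(δ₀ / 10 * M)) * Real.exp (-(δ₀ / 4 * n)) := by ring
      _ ≤ alpha515 d N c₀ δ₀ M * Real.exp (-(δ₀ / 4 * n)) := by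
          apply mul_le_mul_of_nonneg_right _ (Real.exp_pos _).le
          unfold alpha515
          have : 0 ≤ 3 * π * d / (2 * M) * weightConst d N c₀ δ₀ := by positivity
          linarith

end PairBounds

/-! ### (5.15) in the print's `L²` operator norm, by the finite Schur test -/

section L2Norm

open Literature.MathematicalPhysics.QuantumFieldTheory.Balaban1983to89
open B4Commutators25to211 B4GaugeCovariance B4Sect5RandomWalk B4Sect5Proof B6GOmega
open scoped Matrix

variable {N : ℕ} {Λ : Finset (Fin d → ℤ)} {γ₀ c₀ δ₀ : ℝ}

/-- column version of `sum_abs_mul_dist_le`: `Σ_x |A(x,x′)|·|x − x′| ≤ M₀`. [cite: Balaban1983RegularityDecay, (5.6) p.594] -/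
theorem sum_abs_mul_dist_col_le (hc : 0 ≤ c₀) (hδ : 0 < δ₀) (A : Matrix (B4.Idx Λ N) (B4.Idx Λ N) ℝ)
    (hA : ∀ p q : B4.Idx Λ N,
      |A p q| ≤ c₀ * Real.exp (-(δ₀ * dist (p.1 : Fin d → ℤ) (q.1 : Fin d → ℤ))))
    (q : B4.Idx Λ N) :
    ∑ p, |A p q| * dist (p.1 : Fin d → ℤ) (q.1 : Fin d → ℤ) ≤ weightConst d N c₀ δ₀ := by
  have hAt : ∀ p q : B4.Idx Λ N,
      |A.transpose p q| ≤ c₀ * Real.exp (-(δ₀ * dist (p.1 : Fin d → ℤ) (q.1 : Fin d → ℤ))) := by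
    intro p q'; rw [Matrix.transpose_apply, dist_comm]; exact hA q' p
  have h := sum_abs_mul_dist_le hc hδ A.transpose hAt q
  simp only [Matrix.transpose_apply] at h
  refine le_of_eq_of_le (Finset.sum_congr rfl fun p _ => ?_) h
  rw [dist_comm]

/-- column sums of `R_{j,j}`: `Σ_x |R_{j,j}(x,x′)| ≤ (3πd/2M)·M₀`. [cite: Balaban1983RegularityDecay, (5.15) p.595] -/
theorem colSum_rPair_diag_le {M : ℕ} (hM : 0 < M) (hc : 0 ≤ c₀) (hδ : 0 < δ₀)
    {A : Matrix (B4.Idx Λ N) (B4.Idx Λ N) ℝ}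
    (hA : ∀ p q : B4.Idx Λ N,
      |A p q| ≤ c₀ * Real.exp (-(δ₀ * dist (p.1 : Fin d → ℤ) (q.1 : Fin d → ℤ))))
    (j : ↥(labels M Λ)) (q : B4.Idx Λ N) :
    ∑ p, |rPair A (pFam N M Λ) (hFam N M Λ) j j p q| ≤ 3 * π * d / (2 * M) * weightConst d N c₀ δ₀ := by
  calc ∑ p, |rPair A (pFam N M Λ) (hFam N M Λ) j j p q|
      ≤ ∑ p, 3 * π * d / (2 * M) * (|A p q| * dist (p.1 : Fin d → ℤ) (q.1 : Fin d → ℤ)) :=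
        Finset.sum_le_sum fun p _ => (abs_rPair_diag_le hM A j p q).trans (le_of_eq (by ring))
    _ ≤ 3 * π * d / (2 * M) * weightConst d N c₀ δ₀ := by
        rw [← Finset.mul_sum]
        exact mul_le_mul_of_nonneg_left (sum_abs_mul_dist_col_le hc hδ A hA q) (by positivity)

/-- column sums of `R_{j,j′}`, `j ≠ j′`: `Σ_x |R_{j,j′}(x,x′)| ≤ c₀NK_d(δ₀/4)e^{−(3/20)δ₀M|j−j′|}`.
[cite: Balaban1983RegularityDecay, (5.15) p.595] -/
theorem colSum_rPair_offDiag_le {M : ℕ} (hM : 0 < M) (hc : 0 ≤ c₀) (hδ : 0 < δ₀)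
    {A : Matrix (B4.Idx Λ N) (B4.Idx Λ N) ℝ}
    (hA : ∀ p q : B4.Idx Λ N,
      |A p q| ≤ c₀ * Real.exp (-(δ₀ * dist (p.1 : Fin d → ℤ) (q.1 : Fin d → ℤ))))
    {j j' : ↥(labels M Λ)} (hjj' : j ≠ j') (q : B4.Idx Λ N) :
    ∑ p, |rPair A (pFam N M Λ) (hFam N M Λ) j j' p q| ≤
      c₀ * (N * latticeConst d (δ₀ / 4)) *
        Real.exp (-(3 * δ₀ / 20 * M * dist (j.1 : Fin d → ℤ) (j'.1 : Fin d → ℤ))) := by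
  have hK := latticeConst_nonneg d (by positivity : (0:ℝ) ≤ δ₀ / 4)
  calc ∑ p, |rPair A (pFam N M Λ) (hFam N M Λ) j j' p q|
      ≤ ∑ p : B4.Idx Λ N, c₀ * Real.exp (-(δ₀ / 4 * dist (p.1 : Fin d → ℤ) (q.1 : Fin d → ℤ))) *
          Real.exp (-(3 * δ₀ / 20 * M * dist (j.1 : Fin d → ℤ) (j'.1 : Fin d → ℤ))) :=
        Finset.sum_le_sum fun p _ => abs_rPair_offDiag_le'' hM hc hδ.le hA hjj' p q
    _ = c₀ * Real.exp (-(3 * δ₀ / 20 * M * dist (j.1 : Fin d → ℤ) (j'.1 : Fin d → ℤ))) *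
          ∑ p : B4.Idx Λ N, Real.exp (-(δ₀ / 4 * dist (q.1 : Fin d → ℤ) (p.1 : Fin d → ℤ))) := by
        rw [Finset.mul_sum]; refine Finset.sum_congr rfl fun p _ => ?_; rw [dist_comm]; ring
    _ ≤ c₀ * Real.exp (-(3 * δ₀ / 20 * M * dist (j.1 : Fin d → ℤ) (j'.1 : Fin d → ℤ))) *
          (N * latticeConst d (δ₀ / 4)) :=
        mul_le_mul_of_nonneg_left (idxSum_le (by positivity) Λ _) (by positivity)
    _ = _ := by ring

/-- row sums of `R_{j,j′}` (both cases) are `≤ α(M)e^{−¼δ₀|j−j′|}`, `M ≥ 5`. [cite: Balaban1983RegularityDecay, (5.15) p.595] -/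
theorem rowSum_rPair_le {M : ℕ} (hM : 5 ≤ M) (hc : 0 ≤ c₀) (hδ : 0 < δ₀) {A : Matrix (B4.Idx Λ N) (B4.Idx Λ N) ℝ}
    (hA : ∀ p q : B4.Idx Λ N,
      |A p q| ≤ c₀ * Real.exp (-(δ₀ * dist (p.1 : Fin d → ℤ) (q.1 : Fin d → ℤ))))
    (j j' : ↥(labels M Λ)) (p : B4.Idx Λ N) :
    ∑ q, |rPair A (pFam N M Λ) (hFam N M Λ) j j' p q| ≤
      alpha515 d N c₀ δ₀ M * Real.exp (-(δ₀ / 4 * dist (j.1 : Fin d → ℤ) (j'.1 : Fin d → ℤ))) := by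
  have hM0 : 0 < M := by omega
  have hMr : (5 : ℝ) ≤ M := by exact_mod_cast hM
  have hW := weightConst_nonneg d N hc hδ
  have hK := latticeConst_nonneg d (by positivity : (0:ℝ) ≤ δ₀ / 4)
  by_cases hjj' : j = j'
  · subst hjj'
    rw [dist_self, mul_zero, neg_zero, Real.exp_zero, mul_one]
    calc ∑ q, |rPair A (pFam N M Λ) (hFam N M Λ) j j p q|
        ≤ ∑ q, 3 * π * d / (2 * M) * (|A p q| * dist (p.1 : Fin d → ℤ) (q.1 : Fin d → ℤ)) :=
          Finset.sum_le_sum fun q _ => (abs_rPair_diag_le hM0 A j p q).trans (le_of_eq (by ring))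
      _ ≤ 3 * π * d / (2 * M) * weightConst d N c₀ δ₀ := by
          rw [← Finset.mul_sum]
          exact mul_le_mul_of_nonneg_left (sum_abs_mul_dist_le hc hδ A hA p) (by positivity)
      _ ≤ alpha515 d N c₀ δ₀ M := by
          unfold alpha515
          have : 0 ≤ c₀ * (N * latticeConst d (δ₀ / 4)) * Real.exp (-(δ₀ / 10 * M)) := by positivity
          linarith
  · have hne : (j.1 : Fin d → ℤ) ≠ j'.1 := fun e => hjj' (Subtype.ext e)
    have h1 := one_le_dist_of_ne hne
    set n := dist (j.1 : Fin d → ℤ) (j'.1 : Fin d → ℤ) with hn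
    have hsplit : Real.exp (-(3 * δ₀ / 20 * M * n)) ≤ Real.exp (-(δ₀ / 10 * M)) * Real.exp (-(δ₀ / 4 * n)) := by
      rw [← Real.exp_add]
      apply Real.exp_le_exp.mpr
      nlinarith [mul_nonneg (mul_nonneg hδ.le (Nat.cast_nonneg M)) (sub_nonneg.mpr h1),
        mul_nonneg (mul_nonneg hδ.le (by linarith : (0:ℝ) ≤ n)) (sub_nonneg.mpr hMr)]
    calc ∑ q, |rPair A (pFam N M Λ) (hFam N M Λ) j j' p q|
        ≤ ∑ q : B4.Idx Λ N, c₀ * Real.exp (-(δ₀ / 4 * dist (p.1 : Fin d → ℤ) (q.1 : Fin d → ℤ))) *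
            Real.exp (-(3 * δ₀ / 20 * M * n)) :=
          Finset.sum_le_sum fun q _ => abs_rPair_offDiag_le'' hM0 hc hδ.le hA hjj' p q
      _ = c₀ * Real.exp (-(3 * δ₀ / 20 * M * n)) *
            ∑ q : B4.Idx Λ N, Real.exp (-(δ₀ / 4 * dist (p.1 : Fin d → ℤ) (q.1 : Fin d → ℤ))) := by
          rw [Finset.mul_sum]; refine Finset.sum_congr rfl fun q _ => ?_; ring
      _ ≤ c₀ * Real.exp (-(3 * δ₀ / 20 * M * n)) * (N * latticeConst d (δ₀ / 4)) :=
          mul_le_mul_of_nonneg_left (idxSum_le (by positivity) Λ _) (by positivity)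
      _ ≤ c₀ * (Real.exp (-(δ₀ / 10 * M)) * Real.exp (-(δ₀ / 4 * n))) * (N * latticeConst d (δ₀ / 4)) := by
          gcongr
      _ = c₀ * (N * latticeConst d (δ₀ / 4)) * Real.exp (-(δ₀ / 10 * M)) * Real.exp (-(δ₀ / 4 * n)) := by ring
      _ ≤ alpha515 d N c₀ δ₀ M * Real.exp (-(δ₀ / 4 * n)) := by
          apply mul_le_mul_of_nonneg_right _ (Real.exp_pos _).le
          unfold alpha515
          have : 0 ≤ 3 * π * d / (2 * M) * weightConst d N c₀ δ₀ := by positivity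
          linarith

/-- column sums of `R_{j,j′}` (both cases) are `≤ α(M)e^{−¼δ₀|j−j′|}`, `M ≥ 5`. [cite: Balaban1983RegularityDecay, (5.15) p.595] -/
theorem colSum_rPair_le {M : ℕ} (hM : 5 ≤ M) (hc : 0 ≤ c₀) (hδ : 0 < δ₀) {A : Matrix (B4.Idx Λ N) (B4.Idx Λ N) ℝ}
    (hA : ∀ p q : B4.Idx Λ N,
      |A p q| ≤ c₀ * Real.exp (-(δ₀ * dist (p.1 : Fin d → ℤ) (q.1 : Fin d → ℤ))))
    (j j' : ↥(labels M Λ)) (q : B4.Idx Λ N) :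
    ∑ p, |rPair A (pFam N M Λ) (hFam N M Λ) j j' p q| ≤
      alpha515 d N c₀ δ₀ M * Real.exp (-(δ₀ / 4 * dist (j.1 : Fin d → ℤ) (j'.1 : Fin d → ℤ))) := by
  have hM0 : 0 < M := by omega
  have hMr : (5 : ℝ) ≤ M := by exact_mod_cast hM
  have hW := weightConst_nonneg d N hc hδ
  have hK := latticeConst_nonneg d (by positivity : (0:ℝ) ≤ δ₀ / 4)
  by_cases hjj' : j = j'
  · subst hjj'
    rw [dist_self, mul_zero, neg_zero, Real.exp_zero, mul_one]
    refine (colSum_rPair_diag_le hM0 hc hδ hA j q).trans ?_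
    unfold alpha515
    have : 0 ≤ c₀ * (N * latticeConst d (δ₀ / 4)) * Real.exp (-(δ₀ / 10 * M)) := by positivity
    linarith
  · have hne : (j.1 : Fin d → ℤ) ≠ j'.1 := fun e => hjj' (Subtype.ext e)
    have h1 := one_le_dist_of_ne hne
    set n := dist (j.1 : Fin d → ℤ) (j'.1 : Fin d → ℤ) with hn
    have hsplit : Real.exp (-(3 * δ₀ / 20 * M * n)) ≤ Real.exp (-(δ₀ / 10 * M)) * Real.exp (-(δ₀ / 4 * n)) := by
      rw [← Real.exp_add]
      apply Real.exp_le_exp.mpr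
      nlinarith [mul_nonneg (mul_nonneg hδ.le (Nat.cast_nonneg M)) (sub_nonneg.mpr h1),
        mul_nonneg (mul_nonneg hδ.le (by linarith : (0:ℝ) ≤ n)) (sub_nonneg.mpr hMr)]
    refine (colSum_rPair_offDiag_le hM0 hc hδ hA hjj' q).trans ?_
    calc c₀ * (N * latticeConst d (δ₀ / 4)) * Real.exp (-(3 * δ₀ / 20 * M * n))
        ≤ c₀ * (N * latticeConst d (δ₀ / 4)) * (Real.exp (-(δ₀ / 10 * M)) * Real.exp (-(δ₀ / 4 * n))) :=
          mul_le_mul_of_nonneg_left hsplit (by positivity)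
      _ = c₀ * (N * latticeConst d (δ₀ / 4)) * Real.exp (-(δ₀ / 10 * M)) * Real.exp (-(δ₀ / 4 * n)) := by ring
      _ ≤ alpha515 d N c₀ δ₀ M * Real.exp (-(δ₀ / 4 * n)) := by
          apply mul_le_mul_of_nonneg_right _ (Real.exp_pos _).le
          unfold alpha515
          have : 0 ≤ 3 * π * d / (2 * M) * weightConst d N c₀ δ₀ := by positivity
          linarith

/-- **(5.15) IN THE PRINT'S `L²` OPERATOR NORM** (finite Schur test `SchurTest.sum_sq_le` on the row AND column sums):
`‖R_{j,j′}φ‖₂ ≤ α(M)e^{−¼δ₀|j−j′|}‖φ‖₂` for every `φ ∈ L²(Λ; ℝ^N)`, i.e. `Σ_x |(R_{j,j′}φ)(x)|² ≤ (αe^{−δ₂|j−j′|})²Σ_x|φ(x)|²`,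
`M ≥ 5`, under the kernel bound of (5.6). [cite: Balaban1983RegularityDecay, (5.15) p.595] -/
theorem ineq515_l2 {M : ℕ} (hM : 5 ≤ M) (hc : 0 ≤ c₀) (hδ : 0 < δ₀) {A : Matrix (B4.Idx Λ N) (B4.Idx Λ N) ℝ}
    (hA : ∀ p q : B4.Idx Λ N,
      |A p q| ≤ c₀ * Real.exp (-(δ₀ * dist (p.1 : Fin d → ℤ) (q.1 : Fin d → ℤ))))
    (j j' : ↥(labels M Λ)) (φ : B4.Idx Λ N → ℝ) :
    ∑ p, ((rPair A (pFam N M Λ) (hFam N M Λ) j j') *ᵥ φ) p ^ 2 ≤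
      (alpha515 d N c₀ δ₀ M * Real.exp (-(δ₀ / 4 * dist (j.1 : Fin d → ℤ) (j'.1 : Fin d → ℤ)))) ^ 2 *
        ∑ p, φ p ^ 2 := by
  have h := SchurTest.sum_sq_le (fun p q => rPair A (pFam N M Λ) (hFam N M Λ) j j' p q) φ
    (rowSum_rPair_le hM hc hδ hA j j') (colSum_rPair_le hM hc hδ hA j j')
  simp only [Matrix.mulVec, dotProduct]
  rw [sq]
  exact h

end L2Norm

/-! ## §8 (5.17) on the lattice: the restriction, its locality, the weight `θ(M)`, and "we fix M" -/

section WalkInstance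

open Literature.MathematicalPhysics.QuantumFieldTheory.Balaban1983to89
open B4Commutators25to211 B4GaugeCovariance B4Sect5RandomWalk B4Sect5Proof B6GOmega
open scoped Matrix Matrix.Norms.Operator

variable {N : ℕ} {Λ : Finset (Fin d → ℤ)} {γ₀ c₀ δ₀ : ℝ}

/-- **the restriction (5.17)** p. 595, verbatim: *"max_{μ=1,…,d}|ω_{2i,μ} − ω_{2i+1,μ}| ≤ 1"* — adjacency of cube
labels. [cite: Balaban1983RegularityDecay, (5.17) p.595] -/
def Adj (j j' : Fin d → ℤ) : Prop := ∀ μ, |j μ - j' μ| ≤ 1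

/-- decidability of the restriction (5.17). [cite: Balaban1983RegularityDecay, (5.17) p.595] -/
instance instDecidableAdj (j j' : Fin d → ℤ) : Decidable (Adj j j') := by unfold Adj; infer_instance

/-- non-adjacent labels differ by `≥ 2` in some coordinate. [cite: Balaban1983RegularityDecay, (5.17) p.595] -/
theorem exists_two_le_of_not_adj {j j' : Fin d → ℤ} (h : ¬ Adj j j') : ∃ μ, 2 ≤ |j μ - j' μ| := by
  unfold Adj at h; push Not at h
  obtain ⟨μ, hμ⟩ := h
  exact ⟨μ, by omega⟩

/-- multiplication operators commute. [folklore] (bookkeeping for Bałaban, CMP **89**, Sect. 5) -/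
private theorem mulH_comm' {X ι : Type*} [Fintype X] [Fintype ι] [DecidableEq X] [DecidableEq ι] (f g : X → ℝ) :
    mulH (ι := ι) f * mulH (ι := ι) g = mulH (ι := ι) g * mulH (ι := ι) f := by
  rw [mulH_mul_mulH, mulH_mul_mulH]; congr 1; funext x; ring

/-- `mulH 0 = 0`. [folklore] (bookkeeping for Bałaban, CMP **89**, Sect. 5) -/
private theorem mulH_eq_zero_of {X ι : Type*} [Fintype X] [Fintype ι] [DecidableEq X] [DecidableEq ι] {f : X → ℝ}
    (hf : ∀ x, f x = 0) : mulH (ι := ι) f = 0 := by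
  rw [show f = (0 : X → ℝ) from funext hf]; exact mulH_zero

/-- non-adjacent cubes: `h_j□_{j′} = 0` (`supp h_j` does not meet `□_{j′}` when `|j_μ − j′_μ| ≥ 2` for some `μ`) —
the mechanism of the restriction (5.17). [cite: Balaban1983RegularityDecay, (5.17) p.595] -/
theorem hFam_mul_pFam_eq_zero {M : ℕ} (hM : 0 < M) {j j' : ↥(labels M Λ)} (h : ¬ Adj j.1 j'.1) :
    hFam N M Λ j * pFam N M Λ j' = 0 := by
  obtain ⟨μ, hμ⟩ := exists_two_le_of_not_adj h
  simp only [hFam, pFam]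
  rw [mulH_mul_mulH]
  apply mulH_eq_zero_of
  intro x
  by_cases hx : hfun M j.1 (x : Fin d → ℤ) = 0
  · rw [hx, zero_mul]
  · rw [boxInd_eq]
    split_ifs with hbox
    · exfalso
      have h1 := abs_lt_of_hfun_ne_zero hx μ
      have h2 := hbox μ
      have hMr : (0 : ℝ) < M := by exact_mod_cast hM
      have h2a : -(M : ℝ) ≤ (x : Fin d → ℤ) μ - M * j'.1 μ := by exact_mod_cast h2.1
      have h2b : ((x : Fin d → ℤ) μ : ℝ) - M * j'.1 μ < M := by exact_mod_cast h2.2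
      have hμr : (2 : ℝ) ≤ |(j.1 μ : ℝ) - j'.1 μ| := by exact_mod_cast hμ
      have e : ((x : Fin d → ℤ) μ : ℝ) / M - j.1 μ = (((x : Fin d → ℤ) μ : ℝ) - M * j.1 μ) / M := by field_simp
      rw [e, abs_div, abs_of_pos hMr, div_lt_iff₀ hMr] at h1
      rw [abs_lt] at h1
      rcases le_abs'.mp hμr with hn | hp
      · nlinarith
      · nlinarith
    · rw [mul_zero]

/-- non-adjacent cubes: `h_jh_{j′} = 0`. [cite: Balaban1983RegularityDecay, (5.17) p.595] -/
theorem hFam_mul_hFam_eq_zero {M : ℕ} {j j' : ↥(labels M Λ)} (h : ¬ Adj j.1 j'.1) :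
    hFam N M Λ j * hFam N M Λ j' = 0 := by
  obtain ⟨μ, hμ⟩ := exists_two_le_of_not_adj h
  simp only [hFam]
  rw [mulH_mul_mulH]
  apply mulH_eq_zero_of
  intro x
  by_cases hx : hfun M j.1 (x : Fin d → ℤ) = 0
  · rw [hx, zero_mul]
  by_cases hx' : hfun M j'.1 (x : Fin d → ℤ) = 0
  · rw [hx', mul_zero]
  exfalso
  have h1 := abs_lt_of_hfun_ne_zero hx μ
  have h2 := abs_lt_of_hfun_ne_zero hx' μ
  have hμr : (2 : ℝ) ≤ |(j.1 μ : ℝ) - j'.1 μ| := by exact_mod_cast hμ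
  have h3 := abs_sub_le (j.1 μ : ℝ) (((x : Fin d → ℤ) μ : ℝ) / M) (j'.1 μ)
  have e1 : |(j.1 μ : ℝ) - ((x : Fin d → ℤ) μ : ℝ) / M| = |(((x : Fin d → ℤ) μ : ℝ) / M) - j.1 μ| := abs_sub_comm _ _
  rw [e1] at h3
  linarith

/-- THE LOCALITY BEHIND (5.17): `h_jR_{j₁,j₂} = 0` unless `□_j` and `□_{j₁}` are adjacent (*"ω_i are arbitrary
indices j, but satisfying the restrictions max_μ|ω_{2i,μ} − ω_{2i+1,μ}| ≤ 1"*). [cite: Balaban1983RegularityDecay,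
(5.17) p.595] -/
theorem hFam_mul_rPair_eq_zero {M : ℕ} (hM : 0 < M) (A : Matrix (B4.Idx Λ N) (B4.Idx Λ N) ℝ)
    {j j₁ : ↥(labels M Λ)} (h : ¬ Adj j.1 j₁.1) (j₂ : ↥(labels M Λ)) :
    hFam N M Λ j * rPair A (pFam N M Λ) (hFam N M Λ) j₁ j₂ = 0 := by
  rw [rPair]
  split_ifs with h12
  · rw [mul_neg, neg_eq_zero, ← Matrix.mul_assoc, ← Matrix.mul_assoc, hFam_mul_pFam_eq_zero hM h,
      Matrix.zero_mul, Matrix.zero_mul]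
  · rw [mul_neg, neg_eq_zero]
    have hcomm : hFam N M Λ j * (1 - pFam N M Λ j₂) = (1 - pFam N M Λ j₂) * hFam N M Λ j := by
      simp only [hFam, pFam]; rw [one_sub_mulH, mulH_comm']
    calc hFam N M Λ j * ((1 - pFam N M Λ j₂) * (hFam N M Λ j₁ * hFam N M Λ j₁) * A * hFam N M Λ j₂)
        = (hFam N M Λ j * (1 - pFam N M Λ j₂)) * hFam N M Λ j₁ * hFam N M Λ j₁ * A * hFam N M Λ j₂ := by
          simp only [Matrix.mul_assoc]
      _ = (1 - pFam N M Λ j₂) * (hFam N M Λ j * hFam N M Λ j₁) * hFam N M Λ j₁ * A * hFam N M Λ j₂ := by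
          rw [hcomm]; simp only [Matrix.mul_assoc]
      _ = 0 := by rw [hFam_mul_hFam_eq_zero h]; simp

/-- (5.17), first-step locality: `(h_jC_jh_j)·(R_{j₁,j₂}C_{j₂}h_{j₂}) = 0` unless `□_j`, `□_{j₁}` are adjacent
(hypothesis `hloc₀` of `B4Sect5RandomWalk.hasSum517`). [cite: Balaban1983RegularityDecay, (5.17) p.595] -/
theorem aFac_mul_bFac_eq_zero {M : ℕ} (hM : 0 < M) (A : Matrix (B4.Idx Λ N) (B4.Idx Λ N) ℝ)
    (j : ↥(labels M Λ)) (q : ↥(labels M Λ) × ↥(labels M Λ)) (h : ¬ Adj j.1 q.1.1) :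
    aFac (hFam N M Λ) (cFam M A) j * bFac A (pFam N M Λ) (hFam N M Λ) (cFam M A) q = 0 := by
  simp only [aFac, bFac, Matrix.mul_assoc]
  rw [← Matrix.mul_assoc (hFam N M Λ j) (rPair _ _ _ _ _), hFam_mul_rPair_eq_zero hM A h]
  simp

/-- (5.17), step locality: `(R_{q₁,q₂}C_{q₂}h_{q₂})·(R_{q′₁,q′₂}C_{q′₂}h_{q′₂}) = 0` unless `□_{q₂}`, `□_{q′₁}` are
adjacent (hypothesis `hloc` of `B4Sect5RandomWalk.hasSum517`). [cite: Balaban1983RegularityDecay, (5.17) p.595] -/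
theorem bFac_mul_bFac_eq_zero {M : ℕ} (hM : 0 < M) (A : Matrix (B4.Idx Λ N) (B4.Idx Λ N) ℝ)
    (q q' : ↥(labels M Λ) × ↥(labels M Λ)) (h : ¬ Adj q.2.1 q'.1.1) :
    bFac A (pFam N M Λ) (hFam N M Λ) (cFam M A) q * bFac A (pFam N M Λ) (hFam N M Λ) (cFam M A) q' = 0 := by
  simp only [bFac, Matrix.mul_assoc]
  rw [← Matrix.mul_assoc (hFam N M Λ q.2) (rPair _ _ _ _ _), hFam_mul_rPair_eq_zero hM A h]
  simp

/-- `‖C_j‖ ≤ cRow` (`ℓ^∞` operator norm; the print's `‖C_j‖ ≤ γ₀^{−1}`). [cite: Balaban1983RegularityDecay, p.595]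
-/
theorem norm_cFam_le (hγ : 0 < γ₀) (hc : 0 ≤ c₀) (hδ : 0 < δ₀) {A : Matrix (B4.Idx Λ N) (B4.Idx Λ N) ℝ}
    (hA : B4.Hyp56 Λ A γ₀ c₀ δ₀) (M : ℕ) (j : ↥(labels M Λ)) : ‖cFam M A j‖ ≤ cRow d N γ₀ c₀ δ₀ :=
  linfty_opNorm_le_of_rows _ (cRow_nonneg d N hγ hc hδ) fun p => sum_abs_cOp_le hγ hc hδ hA M j.1 p

/-- `‖h_j‖ ≤ 1`. [cite: Balaban1983RegularityDecay, p.595] -/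
theorem norm_hFam_le (M : ℕ) (j : ↥(labels M Λ)) : ‖hFam N M Λ j‖ ≤ 1 := by
  refine linfty_opNorm_le_of_rows _ zero_le_one fun p => ?_
  have e : ∀ q, |hFam N M Λ j p q| = if p = q then |hfun M j.1 (p.1 : Fin d → ℤ)| else 0 := by
    intro q; simp only [hFam, mulH_apply]; split_ifs <;> simp
  simp only [e, Finset.sum_ite_eq, Finset.mem_univ, if_true]
  exact abs_hfun_le_one M _ _

/-- at most `3^d` labels are adjacent to a given one (the successor count of (5.17)). [cite:
Balaban1983RegularityDecay, (5.17) p.595] -/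
theorem card_filter_adj_le (S : Finset (Fin d → ℤ)) (l : Fin d → ℤ) :
    (S.filter fun j => Adj l j).card ≤ 3 ^ d := by
  classical
  calc (S.filter fun j => Adj l j).card
      ≤ (Fintype.piFinset fun μ => ({l μ - 1, l μ, l μ + 1} : Finset ℤ)).card := by
        apply Finset.card_le_card
        intro j hj
        rw [Finset.mem_filter] at hj
        rw [Fintype.mem_piFinset]
        intro μ
        have := hj.2 μ
        rw [abs_le] at this
        rw [Finset.mem_insert, Finset.mem_insert, Finset.mem_singleton]
        omega
    _ = ∏ μ, ({l μ - 1, l μ, l μ + 1} : Finset ℤ).card := Fintype.card_piFinset _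
    _ ≤ ∏ _μ : Fin d, 3 := by
        apply Finset.prod_le_prod' fun μ _ => ?_
        exact (Finset.card_insert_le _ _).trans (by
          have := Finset.card_insert_le (l μ) ({l μ + 1} : Finset ℤ)
          rw [Finset.card_singleton] at this
          omega)
    _ = 3 ^ d := by rw [Finset.prod_const, Finset.card_univ, Fintype.card_fin]

/-- the (5.17)-weight `θ(M) = 3^d·α(M)·cRow·K_d(δ₀/4)`, a bound for `Σ_{(j₁,j₂): j₁ ~ l} ‖R_{j₁,j₂}C_{j₂}h_{j₂}‖`
(the hypothesis `hθ` of `B4Sect5RandomWalk.hasSum517`; the print's *"αγ₀^{−1}Σ_{j∈Z^d}e^{−δ₂|j|}"*). [cite: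
Balaban1983RegularityDecay, (5.15)–(5.17) p.595] -/
noncomputable def theta517 (d N : ℕ) (γ₀ c₀ δ₀ : ℝ) (M : ℕ) : ℝ :=
  3 ^ d * (alpha515 d N c₀ δ₀ M * cRow d N γ₀ c₀ δ₀ * latticeConst d (δ₀ / 4))

/-- **the (5.17)-weight bound**: `Σ_{(j₁,j₂): j₁ ~ l} ‖R_{j₁,j₂}C_{j₂}h_{j₂}‖ ≤ θ(M)` for every label `l` (`M ≥ 5`).
[cite: Balaban1983RegularityDecay, (5.15)–(5.17) p.595] -/
theorem sum_norm_bFac_le (hγ : 0 < γ₀) (hc : 0 ≤ c₀) (hδ : 0 < δ₀) {A : Matrix (B4.Idx Λ N) (B4.Idx Λ N) ℝ}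
    (hA : B4.Hyp56 Λ A γ₀ c₀ δ₀) {M : ℕ} (hM : 5 ≤ M) (l : ↥(labels M Λ)) :
    ∑ q ∈ Finset.univ.filter (fun q : ↥(labels M Λ) × ↥(labels M Λ) => Adj l.1 q.1.1),
      ‖bFac A (pFam N M Λ) (hFam N M Λ) (cFam M A) q‖ ≤ theta517 d N γ₀ c₀ δ₀ M := by
  have hα := alpha515_nonneg d N hc hδ M
  have hC := cRow_nonneg d N hγ hc hδ
  have hK := latticeConst_nonneg d (by positivity : (0:ℝ) ≤ δ₀ / 4)
  set B := alpha515 d N c₀ δ₀ M * cRow d N γ₀ c₀ δ₀ with hB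
  -- one step
  have hstep : ∀ q : ↥(labels M Λ) × ↥(labels M Λ),
      ‖bFac A (pFam N M Λ) (hFam N M Λ) (cFam M A) q‖ ≤
        B * Real.exp (-(δ₀ / 4 * dist (q.1.1 : Fin d → ℤ) (q.2.1 : Fin d → ℤ))) := by
    intro q
    have h1 := ineq515 hM hc hδ hA.2.2 q.1 q.2
    have h2 := norm_cFam_le hγ hc hδ hA M q.2
    have h3 := norm_hFam_le (N := N) M q.2
    have h0 : 0 ≤ alpha515 d N c₀ δ₀ M * Real.exp (-(δ₀ / 4 * dist (q.1.1 : Fin d → ℤ) (q.2.1 : Fin d → ℤ))) := by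
      positivity
    calc ‖bFac A (pFam N M Λ) (hFam N M Λ) (cFam M A) q‖
        = ‖rPair A (pFam N M Λ) (hFam N M Λ) q.1 q.2 * cFam M A q.2 * hFam N M Λ q.2‖ := rfl
      _ ≤ ‖rPair A (pFam N M Λ) (hFam N M Λ) q.1 q.2‖ * ‖cFam M A q.2‖ * ‖hFam N M Λ q.2‖ := norm_mul₃_le
      _ ≤ alpha515 d N c₀ δ₀ M * Real.exp (-(δ₀ / 4 * dist (q.1.1 : Fin d → ℤ) (q.2.1 : Fin d → ℤ))) *
            cRow d N γ₀ c₀ δ₀ * 1 :=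
          mul_le_mul (mul_le_mul h1 h2 (norm_nonneg _) h0) h3 (norm_nonneg _) (mul_nonneg h0 hC)
      _ = _ := by ring
  -- inner lattice sum
  have hinner : ∀ j₁ : ↥(labels M Λ),
      ∑ j₂ : ↥(labels M Λ), Real.exp (-(δ₀ / 4 * dist (j₁.1 : Fin d → ℤ) (j₂.1 : Fin d → ℤ))) ≤
        latticeConst d (δ₀ / 4) := by
    intro j₁
    rw [Finset.sum_coe_sort (labels M Λ)
      (fun j₂ => Real.exp (-(δ₀ / 4 * dist (j₁.1 : Fin d → ℤ) j₂)))]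
    exact latticeSum_le d (by positivity) (labels M Λ) j₁.1
  calc ∑ q ∈ Finset.univ.filter (fun q : ↥(labels M Λ) × ↥(labels M Λ) => Adj l.1 q.1.1),
        ‖bFac A (pFam N M Λ) (hFam N M Λ) (cFam M A) q‖
      ≤ ∑ q ∈ Finset.univ.filter (fun q : ↥(labels M Λ) × ↥(labels M Λ) => Adj l.1 q.1.1),
          B * Real.exp (-(δ₀ / 4 * dist (q.1.1 : Fin d → ℤ) (q.2.1 : Fin d → ℤ))) :=
        Finset.sum_le_sum fun q _ => hstep q
    _ = ∑ j₁ : ↥(labels M Λ), ∑ j₂ : ↥(labels M Λ), (if Adj l.1 j₁.1 then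
          B * Real.exp (-(δ₀ / 4 * dist (j₁.1 : Fin d → ℤ) (j₂.1 : Fin d → ℤ))) else 0) := by
        rw [Finset.sum_filter, Fintype.sum_prod_type]
    _ ≤ ∑ j₁ : ↥(labels M Λ), (if Adj l.1 j₁.1 then B * latticeConst d (δ₀ / 4) else 0) := by
        refine Finset.sum_le_sum fun j₁ _ => ?_
        split_ifs with hadj
        · rw [← Finset.mul_sum]; exact mul_le_mul_of_nonneg_left (hinner j₁) (by positivity)
        · simp
    _ = ((labels M Λ).filter fun j₁ => Adj l.1 j₁).card * (B * latticeConst d (δ₀ / 4)) := by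
        rw [Finset.sum_coe_sort (labels M Λ) (fun j₁ => if Adj l.1 j₁ then B * latticeConst d (δ₀ / 4) else 0),
          ← Finset.sum_filter, Finset.sum_const, nsmul_eq_mul]
    _ ≤ 3 ^ d * (B * latticeConst d (δ₀ / 4)) := by
        apply mul_le_mul_of_nonneg_right _ (by positivity)
        exact_mod_cast card_filter_adj_le (labels M Λ) l.1
    _ = theta517 d N γ₀ c₀ δ₀ M := by rw [theta517, hB]

/-- **(5.17) on `L²(Λ; ℝ^N)`, from (5.6) alone**: for cubes of size `M ≥ 5` with `M > K_R` and `θ(M) < 1`, the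
generalized random walk expansion of `A_Λ^{-1}` — the sum over ALL walks `ω = (ω₀; (ω₁,ω₂), …, (ω_{2n−1},ω_{2n}))` of
`h_{ω₀}C_{ω₀}h_{ω₀}R_{ω₁,ω₂}C_{ω₂}h_{ω₂}⋯R_{ω_{2n−1},ω_{2n}}C_{ω_{2n}}h_{ω_{2n}}` — converges unconditionally to `A_Λ^{-1}`
(`B4Sect5RandomWalk.hasSum517` instantiated). [cite: Balaban1983RegularityDecay, (5.16)–(5.17) p.595] -/
theorem hasSum517_lattice (hγ : 0 < γ₀) (hc : 0 ≤ c₀) (hδ : 0 < δ₀) {A : Matrix (B4.Idx Λ N) (B4.Idx Λ N) ℝ}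
    (hA : B4.Hyp56 Λ A γ₀ c₀ δ₀) {M : ℕ} (hM : 5 ≤ M) (hMR : kR d N γ₀ c₀ δ₀ < M)
    (hθ : theta517 d N γ₀ c₀ δ₀ M < 1) :
    HasSum (walkTerm517 (aFac (hFam N M Λ) (cFam M A)) (bFac A (pFam N M Λ) (hFam N M Λ) (cFam M A))) A⁻¹ := by
  have hM0 : 0 < M := by omega
  have hMr : (0 : ℝ) < M := by exact_mod_cast hM0
  exact hasSum517 (cubeSystem_lattice hM0 hγ hc hδ.le hA)
    (Matrix.nonsing_inv_mul A ((Matrix.isUnit_iff_isUnit_det _).mp (isUnit_of_hyp56 hγ hA)))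
    ((norm_rOp_le hγ hc hδ hA hM0).trans_lt (by rwa [div_lt_one hMr])) (fun j j' : ↥(labels M Λ) => Adj j.1 j'.1)
    (fun j q hq => aFac_mul_bFac_eq_zero hM0 A j q hq) (fun q q' hq => bFac_mul_bFac_eq_zero hM0 A q q' hq)
    (sum_norm_bFac_le hγ hc hδ hA hM) hθ

/-- **(5.17) with the printed restriction**: the same sum restricted to the walks obeying (5.17)
(`max_μ|ω_{2i,μ} − ω_{2i+1,μ}| ≤ 1`) — all other terms vanish. [cite: Balaban1983RegularityDecay, (5.17) p.595] -/
theorem hasSum517_lattice_restricted (hγ : 0 < γ₀) (hc : 0 ≤ c₀) (hδ : 0 < δ₀)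
    {A : Matrix (B4.Idx Λ N) (B4.Idx Λ N) ℝ} (hA : B4.Hyp56 Λ A γ₀ c₀ δ₀) {M : ℕ} (hM : 5 ≤ M)
    (hMR : kR d N γ₀ c₀ δ₀ < M) (hθ : theta517 d N γ₀ c₀ δ₀ M < 1) :
    HasSum (walkTerm517 (aFac (hFam N M Λ) (cFam M A)) (bFac A (pFam N M Λ) (hFam N M Λ) (cFam M A)) ∘ (↑) :
      {ω : Σ n : ℕ, ↥(labels M Λ) × (Fin n → ↥(labels M Λ) × ↥(labels M Λ)) //
        Restr517 (fun j j' : ↥(labels M Λ) => Adj j.1 j'.1) ω} → Matrix (B4.Idx Λ N) (B4.Idx Λ N) ℝ) A⁻¹ := by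
  have hM0 : 0 < M := by omega
  have hMr : (0 : ℝ) < M := by exact_mod_cast hM0
  exact hasSum517_restricted (cubeSystem_lattice hM0 hγ hc hδ.le hA)
    (Matrix.nonsing_inv_mul A ((Matrix.isUnit_iff_isUnit_det _).mp (isUnit_of_hyp56 hγ hA)))
    ((norm_rOp_le hγ hc hδ hA hM0).trans_lt (by rwa [div_lt_one hMr])) (fun j j' : ↥(labels M Λ) => Adj j.1 j'.1)
    (fun j q hq => aFac_mul_bFac_eq_zero hM0 A j q hq) (fun q q' hq => bFac_mul_bFac_eq_zero hM0 A q q' hq)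
    (sum_norm_bFac_le hγ hc hδ hA hM) hθ

/-! ### "we fix M such that …" (p. 596): an explicit sufficient size of the cubes -/

/-- `e^{−x} ≤ 1/x` for `x > 0`. [folklore] (bookkeeping for Bałaban, CMP **89**, Sect. 5) -/
private theorem exp_neg_le_inv {x : ℝ} (hx : 0 < x) : Real.exp (-x) ≤ 1 / x := by
  rw [Real.exp_neg, one_div]
  exact inv_anti₀ hx ((by linarith : x ≤ x + 1).trans (Real.add_one_le_exp x))

/-- the constant `Θ₁ = 3^d·((3πd/2)M₀ + c₀NK_d(δ₀/4)·(10/δ₀))·cRow·K_d(δ₀/4)` with `θ(M) ≤ Θ₁/M` (*"we fix M such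
that …"*, p. 596). [cite: Balaban1983RegularityDecay, p.596] -/
noncomputable def thetaConst (d N : ℕ) (γ₀ c₀ δ₀ : ℝ) : ℝ :=
  3 ^ d * ((3 * π * d / 2 * weightConst d N c₀ δ₀ + c₀ * (N * latticeConst d (δ₀ / 4)) * (10 / δ₀)) *
    cRow d N γ₀ c₀ δ₀ * latticeConst d (δ₀ / 4))

/-- `α(M) ≤ ((3πd/2)M₀ + c₀NK_d(δ₀/4)(10/δ₀))/M` (by `e^{−δ₀M/10} ≤ 10/(δ₀M)`). [cite: Balaban1983RegularityDecay,
(5.15) p.595] -/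
theorem alpha515_le {M : ℕ} (hM : 0 < M) (hc : 0 ≤ c₀) (hδ : 0 < δ₀) :
    alpha515 d N c₀ δ₀ M ≤
      (3 * π * d / 2 * weightConst d N c₀ δ₀ + c₀ * (N * latticeConst d (δ₀ / 4)) * (10 / δ₀)) / M := by
  have hMr : (0 : ℝ) < M := by exact_mod_cast hM
  have hW := weightConst_nonneg d N hc hδ
  have hK := latticeConst_nonneg d (by positivity : (0:ℝ) ≤ δ₀ / 4)
  have he : Real.exp (-(δ₀ / 10 * M)) ≤ 10 / δ₀ / M := by
    refine (exp_neg_le_inv (by positivity)).trans (le_of_eq ?_)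
    field_simp
  unfold alpha515
  rw [add_div]
  apply add_le_add
  · apply le_of_eq; field_simp
  · rw [mul_div_assoc]
    exact mul_le_mul_of_nonneg_left he (by positivity)

/-- `θ(M) ≤ Θ₁/M`. [cite: Balaban1983RegularityDecay, p.596] -/
theorem theta517_le {M : ℕ} (hM : 0 < M) (hγ : 0 < γ₀) (hc : 0 ≤ c₀) (hδ : 0 < δ₀) :
    theta517 d N γ₀ c₀ δ₀ M ≤ thetaConst d N γ₀ c₀ δ₀ / M := by
  have hMr : (0 : ℝ) < M := by exact_mod_cast hM
  have hC := cRow_nonneg d N hγ hc hδ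
  have hK := latticeConst_nonneg d (by positivity : (0:ℝ) ≤ δ₀ / 4)
  unfold theta517 thetaConst
  rw [mul_div_assoc, mul_assoc _ (cRow d N γ₀ c₀ δ₀), mul_assoc _ (cRow d N γ₀ c₀ δ₀), mul_div_right_comm]
  apply mul_le_mul_of_nonneg_left _ (by positivity)
  apply mul_le_mul_of_nonneg_right (alpha515_le hM hc hδ) (by positivity)

/-- **THE WALK EXPANSION FOR ALL SUFFICIENTLY LARGE CUBES** (*"Finally we fix M such that …"*, p. 596): every cube
size `M ≥ 5` with `M > K_R` and `M > Θ₁` gives `HasSum (walk terms of (5.17)) A_Λ^{−1}`. [cite: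
Balaban1983RegularityDecay, (5.16)–(5.17) p.595; p.596] -/
theorem hasSum517_lattice' (hγ : 0 < γ₀) (hc : 0 ≤ c₀) (hδ : 0 < δ₀) {A : Matrix (B4.Idx Λ N) (B4.Idx Λ N) ℝ}
    (hA : B4.Hyp56 Λ A γ₀ c₀ δ₀) {M : ℕ} (hM : 5 ≤ M) (hMR : kR d N γ₀ c₀ δ₀ < M)
    (hMθ : thetaConst d N γ₀ c₀ δ₀ < M) :
    HasSum (walkTerm517 (aFac (hFam N M Λ) (cFam M A)) (bFac A (pFam N M Λ) (hFam N M Λ) (cFam M A))) A⁻¹ := by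
  have hM0 : 0 < M := by omega
  have hMr : (0 : ℝ) < M := by exact_mod_cast hM0
  exact hasSum517_lattice hγ hc hδ hA hM hMR
    ((theta517_le hM0 hγ hc hδ).trans_lt (by rwa [div_lt_one hMr]))

end WalkInstance

end Literature.MathematicalPhysics.QuantumFieldTheory.Balaban1983to89.B4Sect5CubeBounds
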